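import Literature.Probability.Process.ItoCalculusProofs
import Literature.Probability.Process.BrownianQuadraticSums
import Literature.Probability.Process.SimpleProcessProduct
import Literature.Probability.Process.ItoFormulaPathwise
import Literature.Probability.Process.UCPLimit
import Literature.Probability.Process.KolmogorovChentsovHolder
import HarnessLib

/-!
# Itô's formula for Itô processes: the stochastic core

Probabilistic estimates behind the Taylor-expansion proof of Itô's formula for Itô processes
driven by the canonical Brownian motion `B = Literature.brownian` (raw natural filtration
`𝓕⁰ = Literature.brownianFiltration`, pre-Wiener measure `P`), organised so that the final pathwise
argument (`Literature.Probability.Process.ito_formula_path_of_tendsto` in `ItoFormulaPathwise`) only needs almost-sure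
limits along a subsequence of grids:

* generic martingale facts: orthogonality of increments and **quadratic sums of an `L²`
  martingale are bounded in probability uniformly in the grid**
  (`measure_quadSum_ge_le_of_martingale`), hence for elementary integrals `S · B` after
  truncation (`measure_quadSum_integral_ge_le_brownian`);
* **moduli of continuity are small in probability** for processes with a.s. continuous paths
  (`exists_measure_modulus_gt_le`);
* `∫₀ᵗ Hₙ² ds` is bounded in probability along an approximating sequence
  (`exists_forall_measure_setIntegral_sq_gt_le`);
* **the product of a dyadically sampled continuous adapted multiplier with an approximating
  sequence of `σ` approximates `σ Z`** (`isApproxSeq_sample_mul`), whence the Itô integral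
  `K = ∫ σ Z dB` is the u.c.p. limit of `Γₘ · (H_{φ m} · B)` (associativity);
* **CORE 1** (`exists_forall_measure_riemannSum_sub_ge_le`): left-point Riemann sums of
  `Z = ∂ₓf(·, X)` against `J = ∫ σ dB` along the refined grids converge to `K_t` in probability,
  uniformly in the refining simple process;
* **CORE 2** (`exists_forall_measure_quadSum_sub_ge_le`): quadratic sums of `J` over the grid
  cells starting before `r` converge to `∫₀ʳ σ² ds` in probability.

## References

* J.-F. Le Gall, *Brownian Motion, Martingales, and Stochastic Calculus* (2016), Prop. 4.21,
  Prop. 5.9, Thm 5.10.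
* D. Revuz, M. Yor, *Continuous Martingales and Brownian Motion* (3rd ed., 1999), Ch. IV,
  Thm (1.8), Thm (2.2), Prop. (2.4), Thm (2.12), Prop. (2.13), Thm (3.3).
-/

open MeasureTheory ProbabilityTheory Filter Finset Set
open scoped NNReal ENNReal Topology

noncomputable section

namespace Literature.Probability.Process

/-! ### Quadratic sums of square-integrable martingales -/

section Martingale

variable {Ω : Type*} {m : MeasurableSpace Ω} {μ : Measure Ω} [IsFiniteMeasure μ]
  {𝓕 : Filtration ℝ≥0 m} {M : ℝ≥0 → Ω → ℝ}

/-- **Orthogonality of martingale increments**: for a square-integrable martingale and `a ≤ b`,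
`E[(M_b - M_a)²] = E[M_b²] - E[M_a²]`.
Revuz–Yor, *Continuous Martingales and Brownian Motion* (1999), Ch. IV, proof of
Thm (1.3), eq. (1.1) (`E[(M_t - M_s)² | 𝓕_s] = E[M_t² - M_s² | 𝓕_s]`). [folklore] -/
theorem integral_sub_sq_of_martingale (hM : Martingale M 𝓕 μ) (hL2 : ∀ s, MemLp (M s) 2 μ)
    {a b : ℝ≥0} (hab : a ≤ b) :
    ∫ ω, (M b ω - M a ω) ^ 2 ∂μ = ∫ ω, M b ω ^ 2 ∂μ - ∫ ω, M a ω ^ 2 ∂μ := by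
  have hDint : Integrable (M b - M a) μ := ((hL2 b).sub (hL2 a)).integrable one_le_two
  have hcond : μ[M b - M a | 𝓕 a] =ᵐ[μ] 0 := by
    have h1 := condExp_sub ((hL2 b).integrable one_le_two) ((hL2 a).integrable one_le_two) (𝓕 a)
      (μ := μ)
    have h2 := hM.condExp_ae_eq hab
    have h3 : μ[M a | 𝓕 a] = M a :=
      condExp_of_stronglyMeasurable (𝓕.le a) (hM.1 a) ((hL2 a).integrable one_le_two)
    filter_upwards [h1, h2] with ω hω hω'
    rw [hω, Pi.sub_apply, hω', h3, Pi.zero_apply, sub_self]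
  have horth : ∫ ω, M a ω * (M b - M a) ω ∂μ = 0 := by
    have h1 : ∫ ω, (M a * (M b - M a)) ω ∂μ = ∫ ω, (μ[M a * (M b - M a) | 𝓕 a]) ω ∂μ :=
      (integral_condExp (𝓕.le a)).symm
    have h2 := condExp_mul_of_stronglyMeasurable_left (hM.1 a)
      ((hL2 a).integrable_mul ((hL2 b).sub (hL2 a))) hDint (μ := μ) (m := 𝓕 a)
    have h3 : ∫ ω, (μ[M a * (M b - M a) | 𝓕 a]) ω ∂μ = ∫ ω, (0 : ℝ) ∂μ := by
      refine integral_congr_ae ?_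
      filter_upwards [h2, hcond] with ω hω hω'
      rw [hω, Pi.mul_apply, hω', Pi.zero_apply, mul_zero]
    have : ∫ ω, M a ω * (M b - M a) ω ∂μ = ∫ ω, (M a * (M b - M a)) ω ∂μ := rfl
    rw [this, h1, h3, integral_zero]
  have hexp : ∀ ω, M b ω ^ 2 = (M a ω ^ 2 + 2 * (M a ω * (M b - M a) ω)) + (M b ω - M a ω) ^ 2 := by
    intro ω; simp only [Pi.sub_apply]; ring
  have hI0 : Integrable (fun ω ↦ 2 * (M a ω * (M b - M a) ω)) μ :=
    ((hL2 a).integrable_mul ((hL2 b).sub (hL2 a))).const_mul 2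
  have hI1 : Integrable (fun ω ↦ M a ω ^ 2 + 2 * (M a ω * (M b - M a) ω)) μ :=
    (hL2 a).integrable_sq.add hI0
  have hI2 : Integrable (fun ω ↦ (M b ω - M a ω) ^ 2) μ := by
    have := ((hL2 b).sub (hL2 a)).integrable_sq
    exact this
  conv_rhs => rw [integral_congr_ae (ae_of_all _ hexp)]
  rw [integral_add hI1 hI2, integral_add (hL2 a).integrable_sq hI0, MeasureTheory.integral_const_mul,
    horth]
  ring

/-- Second moments of a square-integrable martingale are nondecreasing. [folklore] -/
theorem integral_sq_mono_of_martingale (hM : Martingale M 𝓕 μ) (hL2 : ∀ s, MemLp (M s) 2 μ)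
    {a b : ℝ≥0} (hab : a ≤ b) : ∫ ω, M a ω ^ 2 ∂μ ≤ ∫ ω, M b ω ^ 2 ∂μ := by
  have := integral_sub_sq_of_martingale hM hL2 hab
  linarith [integral_nonneg (μ := μ) (f := fun ω ↦ (M b ω - M a ω) ^ 2) fun ω ↦ sq_nonneg _]

/-- **Expected quadratic sums of a square-integrable martingale telescope**:
`E[∑ᵢ (M_{uᵢ₊₁} - M_{uᵢ})²] = E[M_{u_N}²] - E[M_{u₀}²]` along any finite nondecreasing grid.
Revuz–Yor, *Continuous Martingales and Brownian Motion* (1999), Ch. IV, proof of Thm (1.3).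
[folklore] -/
theorem integral_quadSum_of_martingale (hM : Martingale M 𝓕 μ) (hL2 : ∀ s, MemLp (M s) 2 μ)
    {u : ℕ → ℝ≥0} {N : ℕ} (hu : ∀ i < N, u i ≤ u (i + 1)) :
    ∫ ω, ∑ i ∈ range N, (M (u (i + 1)) ω - M (u i) ω) ^ 2 ∂μ =
      ∫ ω, M (u N) ω ^ 2 ∂μ - ∫ ω, M (u 0) ω ^ 2 ∂μ := by
  rw [integral_finsetSum _ (f := fun i ω ↦ (M (u (i + 1)) ω - M (u i) ω) ^ 2) (fun i _ ↦ by
    have := ((hL2 (u (i + 1))).sub (hL2 (u i))).integrable_sq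
    exact this)]
  rw [sum_congr rfl fun i hi ↦ integral_sub_sq_of_martingale hM hL2 (hu i (mem_range.1 hi)),
    sum_range_sub (fun i ↦ ∫ ω, M (u i) ω ^ 2 ∂μ)]

/-- **Quadratic sums of a square-integrable martingale are bounded in probability**, uniformly
in the grid: `μ {η ≤ ∑ᵢ (M_{uᵢ₊₁} - M_{uᵢ})²} ≤ E[M_{u_N}²] / η` (Markov's inequality and
`integral_quadSum_of_martingale`).
Revuz–Yor, *Continuous Martingales and Brownian Motion* (1999), Ch. IV, proof of Thm (1.8).
[folklore] -/
theorem measure_quadSum_ge_le_of_martingale (hM : Martingale M 𝓕 μ) (hL2 : ∀ s, MemLp (M s) 2 μ)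
    {u : ℕ → ℝ≥0} {N : ℕ} (hu : ∀ i < N, u i ≤ u (i + 1)) {η : ℝ} (hη : 0 < η) :
    μ {ω | η ≤ ∑ i ∈ range N, (M (u (i + 1)) ω - M (u i) ω) ^ 2} ≤
      ENNReal.ofReal ((∫ ω, M (u N) ω ^ 2 ∂μ) / η) := by
  have hint : Integrable (fun ω ↦ ∑ i ∈ range N, (M (u (i + 1)) ω - M (u i) ω) ^ 2) μ :=
    integrable_finsetSum _ fun i _ ↦ by
      have := ((hL2 (u (i + 1))).sub (hL2 (u i))).integrable_sq
      exact this
  have h := mul_meas_ge_le_integral_of_nonneg (ae_of_all _ fun ω ↦ sum_nonneg fun i _ ↦ sq_nonneg _)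
    hint η
  rw [integral_quadSum_of_martingale hM hL2 hu] at h
  have hreal : μ.real {ω | η ≤ ∑ i ∈ range N, (M (u (i + 1)) ω - M (u i) ω) ^ 2} ≤
      (∫ ω, M (u N) ω ^ 2 ∂μ) / η := by
    rw [le_div_iff₀ hη, mul_comm]
    refine h.trans ?_
    linarith [integral_nonneg (μ := μ) (f := fun ω ↦ M (u 0) ω ^ 2) fun ω ↦ sq_nonneg _]
  rw [← ofReal_measureReal]
  exact ENNReal.ofReal_le_ofReal hreal

end Martingale

/-! ### Quadratic sums of elementary integrals against Brownian motion -/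

/-- A bounded step process has time integral `∫₀ᵗ H(s)² ds ≤ (max C 0)² t`. [folklore] -/
theorem SimpleProcess.setIntegral_toProcess_sq_le {Ω : Type*} {m : MeasurableSpace Ω}
    {𝓕 : Filtration ℝ≥0 m} (H : SimpleProcess m 𝓕) {C : ℝ} (hC : ∀ i ω, |H.value i ω| ≤ C)
    (t : ℝ≥0) (ω : Ω) :
    ∫ s in Set.Icc (0 : ℝ) t, (H.toProcess s.toNNReal ω) ^ 2 ≤ (max C 0) ^ 2 * t := by
  rw [H.setIntegral_toProcess_sq]
  have hnn : ∀ i ∈ range (H.times.length - 1),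
      0 ≤ (((min t (H.time (i + 1)) : ℝ≥0) : ℝ) - (min t (H.time i) : ℝ≥0)) := by
    intro i hi
    have hi' : i + 1 < H.times.length := by have := mem_range.1 hi; omega
    exact sub_nonneg.2 (NNReal.coe_le_coe.2 (min_le_min_left _ (H.time_mono (Nat.le_succ i) hi')))
  calc ∑ i ∈ range (H.times.length - 1),
        H.value i ω ^ 2 * ((((min t (H.time (i + 1))) : ℝ≥0) : ℝ) - (min t (H.time i) : ℝ≥0))
      ≤ ∑ i ∈ range (H.times.length - 1),
          (max C 0) ^ 2 * ((((min t (H.time (i + 1))) : ℝ≥0) : ℝ) - (min t (H.time i) : ℝ≥0)) := by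
        refine sum_le_sum fun i hi ↦ mul_le_mul_of_nonneg_right ?_ (hnn i hi)
        rw [← sq_abs]
        exact pow_le_pow_left₀ (abs_nonneg _) ((hC i ω).trans (le_max_left _ _)) 2
    _ = (max C 0) ^ 2 * ((((min t (H.time (H.times.length - 1))) : ℝ≥0) : ℝ) -
          (min t (H.time 0) : ℝ≥0)) := by
        rw [← mul_sum, sum_range_sub (fun i ↦ (((min t (H.time i)) : ℝ≥0) : ℝ))]
    _ ≤ (max C 0) ^ 2 * t := by
        refine mul_le_mul_of_nonneg_left ?_ (sq_nonneg _)
        have h1 : (((min t (H.time (H.times.length - 1))) : ℝ≥0) : ℝ) ≤ t :=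
          NNReal.coe_le_coe.2 (min_le_left _ _)
        linarith [NNReal.coe_nonneg (min t (H.time 0))]

/-- **Quadratic sums of an elementary Itô integral are bounded in probability, uniformly in the
grid**: for a bounded simple process `S` on the Brownian filtration, a nondecreasing grid
`u₀ ≤ ⋯ ≤ u_N ≤ t` and `η, δ > 0`,
`P ({η ≤ ∑ᵢ (Δᵢ (S · B))²} ∖ {δ < ∫₀ᵗ S² ds}) ≤ δ / η`
(truncate `S` at level `δ` of its time integral — this does not change `S · B` on
`{∫₀ᵗ S² ≤ δ}` — and apply `measure_quadSum_ge_le_of_martingale` to the martingale `S^δ · B`,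
whose second moment at `u_N ≤ t` is `≤ E ∫₀ᵗ (S^δ)² ≤ δ` by the Itô isometry).
Revuz–Yor, *Continuous Martingales and Brownian Motion* (1999), Ch. IV, Thm (1.8) and Thm (2.12);
Le Gall (2016), Prop. 4.21. [folklore] -/
theorem measure_quadSum_integral_ge_le_brownian
    (S : SimpleProcess (inferInstance : MeasurableSpace (ℝ≥0 → ℝ)) RandomPlanarGeometry.brownianFiltration) (t : ℝ≥0)
    {u : ℕ → ℝ≥0} {N : ℕ} (hu : ∀ i < N, u i ≤ u (i + 1)) (huN : u N ≤ t) {η δ : ℝ}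
    (hη : 0 < η) (hδ : 0 < δ) :
    preWienerMeasure ({ω | η ≤ ∑ i ∈ range N,
        (S.integral brownian (u (i + 1)) ω - S.integral brownian (u i) ω) ^ 2} \
      {ω | δ < ∫ s in Set.Icc (0 : ℝ) t, (S.toProcess s.toNNReal ω) ^ 2}) ≤
        ENNReal.ofReal (δ / η) := by
  haveI := RandomPlanarGeometry.isProbabilityMeasure_preWienerMeasure'
  set S' := S.truncate t δ with hS'
  have hsub : {ω | η ≤ ∑ i ∈ range N,
      (S.integral brownian (u (i + 1)) ω - S.integral brownian (u i) ω) ^ 2} \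
      {ω | δ < ∫ s in Set.Icc (0 : ℝ) t, (S.toProcess s.toNNReal ω) ^ 2} ⊆
        {ω | η ≤ ∑ i ∈ range N,
          (S'.integral brownian (u (i + 1)) ω - S'.integral brownian (u i) ω) ^ 2} := by
    rintro ω ⟨hω, hω'⟩
    have h : ∫ s in Set.Icc (0 : ℝ) t, (S.toProcess s.toNNReal ω) ^ 2 ≤ δ := not_lt.1 hω'
    simp only [Set.mem_setOf_eq, hS', S.integral_truncate_eq t δ brownian h] at hω ⊢
    exact hω
  refine (measure_mono hsub).trans ?_
  refine (measure_quadSum_ge_le_of_martingale (martingale_integral_brownian S')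
    (memLp_two_integral_brownian S') hu hη).trans (ENNReal.ofReal_le_ofReal ?_)
  refine div_le_div_of_nonneg_right ?_ hη.le
  calc ∫ ω, S'.integral brownian (u N) ω ^ 2 ∂preWienerMeasure
      ≤ ∫ ω, S'.integral brownian t ω ^ 2 ∂preWienerMeasure :=
        integral_sq_mono_of_martingale (martingale_integral_brownian S') (memLp_two_integral_brownian S') huN
    _ = ∫ ω, (∫ s in Set.Icc (0 : ℝ) t, (S'.toProcess s.toNNReal ω) ^ 2) ∂preWienerMeasure :=
        itoIsometry_simple_holds S' t
    _ ≤ ∫ _, δ ∂preWienerMeasure :=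
        integral_mono_of_nonneg (ae_of_all _ fun ω ↦ integral_nonneg fun s ↦ sq_nonneg _)
          (integrable_const δ) (ae_of_all _ fun ω ↦ S.setIntegral_toProcess_truncate_sq_le t hδ.le ω)
    _ = δ := by simp

/-! ### Moduli of continuity in probability -/

section Modulus

open KolmogorovChentsov

variable {Ω : Type*} {mΩ : MeasurableSpace Ω} {P : Measure Ω}

/-- **From a modulus of continuity on the dyadics to a modulus on reals**, for a continuous
path: if `|z d - z d'| ≤ θ` for all dyadic `d, d' ≤ T` with `|d - d'| ≤ 2ρ`, then
`|z s - z s'| ≤ θ` for all real `s, s' ≤ T` with `|s - s'| ≤ ρ` (approximate by dyadic floors and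
pass to the limit). [folklore] -/
theorem modulus_of_modulus_dyad {z : ℝ≥0 → ℝ} (hz : Continuous z) {T : ℝ≥0} {ρ θ : ℝ}
    (hρ : 0 < ρ)
    (h : ∀ m k m' k' : ℕ, dyad m k ≤ T → dyad m' k' ≤ T →
      |(dyad m k : ℝ) - dyad m' k'| ≤ 2 * ρ → |z (dyad m k) - z (dyad m' k')| ≤ θ)
    {s s' : ℝ≥0} (hs : s ≤ T) (hs' : s' ≤ T) (hss' : |(s : ℝ) - s'| ≤ ρ) :
    |z s - z s'| ≤ θ := by
  -- dyadic floors of `s` and `s'`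
  set d : ℕ → ℝ≥0 := fun m ↦ dyad m ⌊(s : ℝ) * 2 ^ m⌋₊ with hd
  set d' : ℕ → ℝ≥0 := fun m ↦ dyad m ⌊(s' : ℝ) * 2 ^ m⌋₊ with hd'
  have hdt : Tendsto d atTop (𝓝 s) := (tendsto_nhdsWithin_iff.1 (tendsto_dyad_floor s)).1
  have hdt' : Tendsto d' atTop (𝓝 s') := (tendsto_nhdsWithin_iff.1 (tendsto_dyad_floor s')).1
  have hlim : Tendsto (fun m ↦ |z (d m) - z (d' m)|) atTop (𝓝 |z s - z s'|) :=
    ((hz.tendsto s |>.comp hdt).sub (hz.tendsto s' |>.comp hdt')).abs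
  refine le_of_tendsto hlim ?_
  -- eventually the dyadic floors are within `2ρ` of each other
  obtain ⟨m₀, hm₀⟩ := exists_pow_lt_of_lt_one (half_pos hρ) (by norm_num : (2⁻¹ : ℝ) < 1)
  refine eventually_atTop.2 ⟨m₀, fun m hm ↦ h _ _ _ _ ((dyad_floor_le s m).trans hs)
    ((dyad_floor_le s' m).trans hs') ?_⟩
  have h1 : |(d m : ℝ) - s| ≤ (2 ^ m)⁻¹ := by
    have := dist_dyad_floor_le s m; rwa [NNReal.dist_eq] at this
  have h2 : |(d' m : ℝ) - s'| ≤ (2 ^ m)⁻¹ := by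
    have := dist_dyad_floor_le s' m; rwa [NNReal.dist_eq] at this
  have h3 : ((2 : ℝ) ^ m)⁻¹ ≤ ρ / 2 := by
    rw [← inv_pow]
    exact ((pow_le_pow_of_le_one (by norm_num) (by norm_num) hm).trans hm₀.le)
  calc |(d m : ℝ) - d' m| = |((d m : ℝ) - s) + ((s : ℝ) - s') + ((s' : ℝ) - d' m)| := by ring_nf
    _ ≤ |(d m : ℝ) - s| + |(s : ℝ) - s'| + |(s' : ℝ) - d' m| := abs_add_three _ _ _
    _ ≤ (2 ^ m)⁻¹ + ρ + (2 ^ m)⁻¹ := by rw [abs_sub_comm (s' : ℝ)]; gcongr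
    _ ≤ 2 * ρ := by linarith

/-- **Moduli of continuity are small in probability** (equicontinuity in probability of a
process with a.s. continuous paths and measurable marginals): for `θ > 0`, `ε > 0` and a horizon
`t` there is `ρ > 0` such that the (outer) probability that the path oscillates by more than `θ`
over some pair of times `s, s' ≤ t` with `|s - s'| ≤ ρ` is at most `ε`. Proof: the events
"`θ`-modulus at scale `2/(N+1)` on the dyadics of `[0, t]`" are measurable, increase with `N`, and
exhaust the continuous paths (uniform continuity); then `modulus_of_modulus_dyad`.
Revuz–Yor, *Continuous Martingales and Brownian Motion* (1999), Ch. IV, proof of Prop. (2.13)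
(continuity of paths ⇒ uniform smallness of oscillations); Le Gall (2016), proof of Thm 5.10.
[folklore] -/
theorem exists_measure_modulus_gt_le [IsFiniteMeasure P] {Z : ℝ≥0 → Ω → ℝ}
    (hZm : ∀ s, Measurable (Z s)) (hZc : ∀ᵐ ω ∂P, Continuous (Z · ω)) (t : ℝ≥0) {θ : ℝ}
    (hθ : 0 < θ) {ε : ℝ≥0∞} (hε : 0 < ε) :
    ∃ ρ > (0 : ℝ), P {ω | ∃ s ≤ t, ∃ s' ≤ t, |(s : ℝ) - s'| ≤ ρ ∧ θ < |Z s ω - Z s' ω|} ≤ ε := by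
  -- the dyadic modulus events
  let W : ℕ → Set Ω := fun N ↦ {ω | ∀ m k m' k' : ℕ, dyad m k ≤ t → dyad m' k' ≤ t →
    |(dyad m k : ℝ) - dyad m' k'| ≤ 2 * (1 / ((N : ℝ) + 1)) → |Z (dyad m k) ω - Z (dyad m' k') ω| ≤ θ}
  have hWmeas : ∀ N, MeasurableSet (W N) := by
    intro N
    have : W N = ⋂ m : ℕ, ⋂ k : ℕ, ⋂ m' : ℕ, ⋂ k' : ℕ, {ω | dyad m k ≤ t → dyad m' k' ≤ t →
        |(dyad m k : ℝ) - dyad m' k'| ≤ 2 * (1 / ((N : ℝ) + 1)) →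
          |Z (dyad m k) ω - Z (dyad m' k') ω| ≤ θ} := by
      ext ω; simp only [W, mem_setOf_eq, mem_iInter]
    rw [this]
    refine MeasurableSet.iInter fun m ↦ MeasurableSet.iInter fun k ↦
      MeasurableSet.iInter fun m' ↦ MeasurableSet.iInter fun k' ↦ ?_
    by_cases hc : dyad m k ≤ t ∧ dyad m' k' ≤ t ∧ |(dyad m k : ℝ) - dyad m' k'| ≤ 2 * (1 / ((N : ℝ) + 1))
    · have : {ω | dyad m k ≤ t → dyad m' k' ≤ t →
          |(dyad m k : ℝ) - dyad m' k'| ≤ 2 * (1 / ((N : ℝ) + 1)) →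
            |Z (dyad m k) ω - Z (dyad m' k') ω| ≤ θ} =
          {ω | |Z (dyad m k) ω - Z (dyad m' k') ω| ≤ θ} := by
        ext ω; simp only [mem_setOf_eq]; exact ⟨fun h ↦ h hc.1 hc.2.1 hc.2.2, fun h _ _ _ ↦ h⟩
      rw [this]
      exact measurableSet_le (continuous_abs.measurable.comp ((hZm (dyad m k)).sub (hZm (dyad m' k'))))
        measurable_const
    · have : {ω | dyad m k ≤ t → dyad m' k' ≤ t →
          |(dyad m k : ℝ) - dyad m' k'| ≤ 2 * (1 / ((N : ℝ) + 1)) →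
            |Z (dyad m k) ω - Z (dyad m' k') ω| ≤ θ} = univ := by
        ext ω; simp only [mem_setOf_eq, mem_univ, iff_true]
        intro h1 h2 h3; exact absurd ⟨h1, h2, h3⟩ hc
      rw [this]; exact MeasurableSet.univ
  -- continuous paths are eventually in `W N`
  have hexhaust : ∀ᵐ ω ∂P, ∀ᶠ N in atTop, ω ∈ W N := by
    filter_upwards [hZc] with ω hω
    have huc := (isCompact_Icc (a := (0 : ℝ≥0)) (b := t)).uniformContinuousOn_of_continuous
      hω.continuousOn
    obtain ⟨δ, hδ, hδ'⟩ := Metric.uniformContinuousOn_iff_le.1 huc θ hθ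
    obtain ⟨N₀, hN₀⟩ := exists_nat_gt (2 / δ)
    refine eventually_atTop.2 ⟨N₀, fun N hN m k m' k' h1 h2 h3 ↦ ?_⟩
    have hN' : 2 * (1 / ((N : ℝ) + 1)) ≤ δ := by
      rw [mul_one_div, div_le_iff₀ (by positivity)]
      rw [div_lt_iff₀ hδ] at hN₀
      have : (N₀ : ℝ) ≤ N := by exact_mod_cast hN
      nlinarith
    have := hδ' (dyad m k) ⟨zero_le, h1⟩ (dyad m' k') ⟨zero_le, h2⟩
      (by rw [NNReal.dist_eq]; exact h3.trans hN')
    rwa [Real.dist_eq] at this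
  -- hence `P (W N)ᶜ → 0`; pick `N`
  have htend : Tendsto (fun N ↦ P (W N)ᶜ) atTop (𝓝 0) := by
    -- `(W N)ᶜ` decreases to a null set
    have hanti : Antitone fun N ↦ (W N)ᶜ := by
      intro N N' hNN'
      refine compl_subset_compl.2 fun ω hω m k m' k' h1 h2 h3 ↦ hω m k m' k' h1 h2 (h3.trans ?_)
      gcongr
    have hnull : P (⋂ N, (W N)ᶜ) = 0 := by
      rw [measure_eq_zero_iff_ae_notMem]
      filter_upwards [hexhaust] with ω hω hmem
      obtain ⟨N, hN⟩ := eventually_atTop.1 hω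
      exact (mem_iInter.1 hmem N) (hN N le_rfl)
    have := tendsto_measure_iInter_atTop (μ := P) (fun N ↦ (hWmeas N).compl.nullMeasurableSet)
      hanti ⟨0, measure_ne_top _ _⟩
    rwa [hnull] at this
  obtain ⟨N, hN⟩ := (ENNReal.tendsto_nhds_zero.1 htend ε hε).exists
  -- conclude with `ρ = 1 / (N + 1)`
  refine ⟨1 / ((N : ℝ) + 1), by positivity, (measure_mono ?_).trans
    ((measure_union_le ((W N)ᶜ) {ω | ¬ Continuous (Z · ω)}).trans ?_)⟩
  · rintro ω ⟨s, hs, s', hs', hss', hθ'⟩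
    by_cases hc : Continuous (Z · ω)
    · left
      intro hW
      exact absurd (modulus_of_modulus_dyad hc (by positivity) hW hs hs' hss') (not_le.2 hθ')
    · right; exact hc
  · rw [ae_iff] at hZc
    rw [hZc, add_zero]
    exact hN


end Modulus

/-! ### Joint measurability and time integrals of progressive integrands -/

section Progressive

variable {Ω : Type*} {m : MeasurableSpace Ω}

/-- A (strongly) progressively measurable real process, read on `Ω × ℝ` through `Real.toNNReal`,
is jointly measurable (exhaust `ℝ≥0` by the intervals `[0, n]`).
Revuz–Yor, *Continuous Martingales and Brownian Motion* (1999), Ch. I, Def. (4.7). [folklore] -/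
theorem measurable_uncurry_of_isStronglyProgressive {𝓕 : Filtration ℝ≥0 m} {σ : ℝ≥0 → Ω → ℝ}
    (hσ : IsStronglyProgressive 𝓕 σ) : Measurable fun p : Ω × ℝ ↦ σ p.2.toNNReal p.1 := by
  have hsec : ∀ n : ℕ, Measurable fun p : Ω × ℝ≥0 ↦ σ (min p.2 n) p.1 := by
    intro n
    have h1 : StronglyMeasurable[Subtype.instMeasurableSpace.prod (𝓕 n)]
        (fun p : Set.Iic (n : ℝ≥0) × Ω ↦ σ p.1 p.2) := hσ n
    have hle : (Subtype.instMeasurableSpace.prod (𝓕 n) : MeasurableSpace (Set.Iic (n : ℝ≥0) × Ω)) ≤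
        Subtype.instMeasurableSpace.prod m :=
      sup_le_sup le_rfl (MeasurableSpace.comap_mono (𝓕.le n))
    have h1' : StronglyMeasurable (fun p : Set.Iic (n : ℝ≥0) × Ω ↦ σ p.1 p.2) := h1.mono hle
    have h2 : Measurable fun p : Ω × ℝ≥0 ↦
        ((⟨min p.2 n, Set.mem_Iic.2 (min_le_right _ _)⟩ : Set.Iic (n : ℝ≥0)), p.1) :=
      ((measurable_snd.min measurable_const).subtype_mk).prodMk measurable_fst
    exact h1'.measurable.comp h2
  have hlim : ∀ p : Ω × ℝ≥0, Tendsto (fun n : ℕ ↦ σ (min p.2 n) p.1) atTop (𝓝 (σ p.2 p.1)) := by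
    intro p
    refine tendsto_const_nhds.congr' ?_
    obtain ⟨N, hN⟩ := exists_nat_ge p.2
    filter_upwards [Filter.eventually_ge_atTop N] with n hn
    rw [min_eq_left (hN.trans (Nat.cast_le.2 hn))]
  have : Measurable fun p : Ω × ℝ≥0 ↦ σ p.2 p.1 :=
    measurable_of_tendsto_metrizable hsec (tendsto_pi_nhds.2 hlim)
  exact this.comp (measurable_fst.prodMk (measurable_real_toNNReal.comp measurable_snd))

end Progressive

/-! ### `∫₀ᵗ Hₙ² ds` is bounded in probability along an approximating sequence -/

/-- **The time integrals `∫₀ᵗ Hₙ(s)² ds` of an approximating sequence are bounded in probability,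
uniformly in `n`**: if `Hₙ → σ` in the sense of `SimpleProcess.IsApproxSeq`, `σ` is jointly
measurable and `∫₀ᵗ σ² < ∞` a.s., then for every `ε > 0` there is a level `L` with
`P {L < ∫₀ᵗ Hₙ² ds} ≤ ε` for all `n` (`Hₙ² ≤ 2 (Hₙ - σ)² + 2 σ²`; finitely many `n` are handled
by the sup bounds of the simple processes).
Revuz–Yor, *Continuous Martingales and Brownian Motion* (1999), Ch. IV, Def. (2.6) and
Prop. (2.13). [folklore] -/
theorem exists_forall_measure_setIntegral_sq_gt_le {Ω : Type*} {m : MeasurableSpace Ω}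
    {P : Measure Ω} [IsFiniteMeasure P] {𝓕 : Filtration ℝ≥0 m} {H : ℕ → SimpleProcess m 𝓕}
    {σ : ℝ≥0 → Ω → ℝ} (hσj : Measurable fun p : Ω × ℝ ↦ σ p.2.toNNReal p.1)
    (hH : SimpleProcess.IsApproxSeq H σ P) (t : ℝ≥0)
    (hfin : ∀ᵐ ω ∂P, ∫⁻ s in Set.Icc (0 : ℝ) t, ENNReal.ofReal (σ s.toNNReal ω ^ 2) < ∞)
    {ε : ℝ≥0∞} (hε : 0 < ε) :
    ∃ L : ℝ, ∀ n, P {ω | L < ∫ s in Set.Icc (0 : ℝ) t, ((H n).toProcess s.toNNReal ω) ^ 2} ≤ ε := by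
  have hε2 : 0 < ε / 2 := ENNReal.half_pos hε.ne'
  -- Step 1: `P {M ≤ ∫₀ᵗ σ²} → 0`
  have hImeas : Measurable fun ω ↦ ∫⁻ s in Set.Icc (0 : ℝ) t, ENNReal.ofReal (σ s.toNNReal ω ^ 2) :=
    ((hσj.pow_const 2).ennreal_ofReal).lintegral_prod_right'
      (ν := volume.restrict (Set.Icc (0 : ℝ) t))
  have hσlim : Tendsto (fun M : ℕ ↦ P {ω | (M : ℝ≥0∞) ≤
      ∫⁻ s in Set.Icc (0 : ℝ) t, ENNReal.ofReal (σ s.toNNReal ω ^ 2)}) atTop (𝓝 0) := by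
    have hanti : Antitone fun M : ℕ ↦ {ω | (M : ℝ≥0∞) ≤
        ∫⁻ s in Set.Icc (0 : ℝ) t, ENNReal.ofReal (σ s.toNNReal ω ^ 2)} :=
      fun M M' hMM' ω (hω : (M' : ℝ≥0∞) ≤ _) ↦ (show (M : ℝ≥0∞) ≤ M' by exact_mod_cast hMM').trans hω
    have hnull : P (⋂ M : ℕ, {ω | (M : ℝ≥0∞) ≤
        ∫⁻ s in Set.Icc (0 : ℝ) t, ENNReal.ofReal (σ s.toNNReal ω ^ 2)}) = 0 := by
      rw [measure_eq_zero_iff_ae_notMem]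
      filter_upwards [hfin] with ω hω hmem
      simp only [Set.mem_iInter, Set.mem_setOf_eq] at hmem
      obtain ⟨M, hM⟩ := ENNReal.exists_nat_gt hω.ne
      exact absurd (hmem M) (not_le.2 hM)
    have := tendsto_measure_iInter_atTop (μ := P)
      (fun M ↦ (measurableSet_le measurable_const hImeas).nullMeasurableSet) hanti
      ⟨0, measure_ne_top _ _⟩
    rwa [hnull] at this
  obtain ⟨M, hM⟩ := (ENNReal.tendsto_nhds_zero.1 hσlim (ε / 2) hε2).exists
  -- Step 2: the approximation error is eventually small
  have hA := hH t 1 one_pos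
  rw [ENNReal.tendsto_nhds_zero] at hA
  obtain ⟨N₀, hN₀⟩ := eventually_atTop.1 (hA (ε / 2) hε2)
  -- Step 3: the finitely many `n < N₀`
  have hbnd : ∀ n, ∃ C : ℝ, ∀ ω, ∫ s in Set.Icc (0 : ℝ) t, ((H n).toProcess s.toNNReal ω) ^ 2 ≤ C := by
    intro n
    obtain ⟨C, hC⟩ := (H n).bounded
    exact ⟨(max C 0) ^ 2 * t, fun ω ↦ (H n).setIntegral_toProcess_sq_le hC t ω⟩
  choose Cn hCn using hbnd
  set B₀ : ℝ := ∑ n ∈ range N₀, |Cn n| with hB₀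
  refine ⟨max (2 + 2 * M) B₀, fun n ↦ ?_⟩
  rcases lt_or_ge n N₀ with hn | hn
  · -- the event is empty
    have : {ω | max (2 + 2 * (M : ℝ)) B₀ < ∫ s in Set.Icc (0 : ℝ) t,
        ((H n).toProcess s.toNNReal ω) ^ 2} = ∅ := by
      ext ω
      simp only [Set.mem_setOf_eq, Set.mem_empty_iff_false, iff_false, not_lt]
      refine (hCn n ω).trans ((le_abs_self _).trans ((single_le_sum (f := fun n ↦ |Cn n|)
        (fun i _ ↦ abs_nonneg _) (mem_range.2 hn)).trans (le_max_right _ _)))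
    rw [this, measure_empty]
    exact bot_le
  · -- `n ≥ N₀`: split according to the two bad events
    have hsub : {ω | max (2 + 2 * (M : ℝ)) B₀ < ∫ s in Set.Icc (0 : ℝ) t,
        ((H n).toProcess s.toNNReal ω) ^ 2} ⊆
        {ω | ENNReal.ofReal 1 ≤ ∫⁻ s in Set.Icc (0 : ℝ) t,
          ENNReal.ofReal (((H n).toProcess s.toNNReal ω - σ s.toNNReal ω) ^ 2)} ∪
        {ω | (M : ℝ≥0∞) ≤ ∫⁻ s in Set.Icc (0 : ℝ) t, ENNReal.ofReal (σ s.toNNReal ω ^ 2)} := by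
      intro ω hω
      by_contra hcon
      simp only [Set.mem_union, Set.mem_setOf_eq, not_or, not_le] at hcon
      obtain ⟨h1, h2⟩ := hcon
      have hσω : Measurable fun s : ℝ ↦ σ s.toNNReal ω := hσj.comp measurable_prodMk_left
      have hHω : Measurable fun s : ℝ ↦ (H n).toProcess s.toNNReal ω :=
        (H n).measurable_toProcess_prod.comp measurable_prodMk_left
      -- `∫ Hₙ² ≤ 2 ∫(Hₙ-σ)² + 2 ∫σ² < 2 + 2M`
      have hmeas : Measurable fun s : ℝ ↦ ((H n).toProcess s.toNNReal ω) ^ 2 := hHω.pow_const 2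
      have hlt : ∫⁻ s in Set.Icc (0 : ℝ) t, ENNReal.ofReal (((H n).toProcess s.toNNReal ω) ^ 2) <
          ENNReal.ofReal (2 + 2 * M) := by
        have hdm : Measurable fun s : ℝ ↦
            ENNReal.ofReal (((H n).toProcess s.toNNReal ω - σ s.toNNReal ω) ^ 2) :=
          ((hHω.sub hσω).pow_const 2).ennreal_ofReal
        calc ∫⁻ s in Set.Icc (0 : ℝ) t, ENNReal.ofReal (((H n).toProcess s.toNNReal ω) ^ 2)
            ≤ ∫⁻ s in Set.Icc (0 : ℝ) t,
                (2 * ENNReal.ofReal (((H n).toProcess s.toNNReal ω - σ s.toNNReal ω) ^ 2) +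
                  2 * ENNReal.ofReal (σ s.toNNReal ω ^ 2)) := by
              refine lintegral_mono fun s ↦ ?_
              have := ofReal_sub_sq_le ((H n).toProcess s.toNNReal ω - σ s.toNNReal ω)
                (-σ s.toNNReal ω)
              simp only [sub_neg_eq_add, sub_add_cancel, even_two, Even.neg_pow] at this
              exact this
          _ = 2 * (∫⁻ s in Set.Icc (0 : ℝ) t,
                ENNReal.ofReal (((H n).toProcess s.toNNReal ω - σ s.toNNReal ω) ^ 2)) +
              2 * ∫⁻ s in Set.Icc (0 : ℝ) t, ENNReal.ofReal (σ s.toNNReal ω ^ 2) := by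
              rw [lintegral_add_left (hdm.const_mul 2), lintegral_const_mul _ hdm,
                lintegral_const_mul _ ((hσω.pow_const 2).ennreal_ofReal)]
          _ < 2 * ENNReal.ofReal 1 + 2 * (M : ℝ≥0∞) := by
              have h1' := ENNReal.mul_lt_mul_left two_ne_zero ENNReal.ofNat_ne_top h1
              have h2' := ENNReal.mul_lt_mul_left two_ne_zero ENNReal.ofNat_ne_top h2
              rw [mul_comm _ (2 : ℝ≥0∞), mul_comm _ (2 : ℝ≥0∞)] at h1' h2'
              exact ENNReal.add_lt_add h1' h2'
          _ = ENNReal.ofReal (2 + 2 * M) := by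
              rw [ENNReal.ofReal_add (by norm_num) (by positivity), ENNReal.ofReal_mul zero_le_two,
                ENNReal.ofReal_one, mul_one, ENNReal.ofReal_ofNat, ENNReal.ofReal_natCast]
      have hreal : ∫ s in Set.Icc (0 : ℝ) t, ((H n).toProcess s.toNNReal ω) ^ 2 < 2 + 2 * M := by
        rw [integral_eq_lintegral_of_nonneg_ae (ae_of_all _ fun s ↦ sq_nonneg _)
          hmeas.aestronglyMeasurable]
        exact (ENNReal.toReal_lt_of_lt_ofReal hlt)
      exact absurd (lt_of_le_of_lt (le_max_left _ _) hω) (not_lt.2 hreal.le)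
    calc P {ω | max (2 + 2 * (M : ℝ)) B₀ < ∫ s in Set.Icc (0 : ℝ) t, ((H n).toProcess s.toNNReal ω) ^ 2}
        ≤ _ := measure_mono hsub
      _ ≤ _ := measure_union_le _ _
      _ ≤ ε / 2 + ε / 2 := add_le_add (hN₀ n hn) hM
      _ = ε := ENNReal.add_halves ε

/-! ### A fast approximating subsequence, and the approximating sequence of `σ Z` -/

section Approx

variable {Ω : Type*} {m : MeasurableSpace Ω} {P : Measure Ω} {𝓕 : Filtration ℝ≥0 m}

/-- **A fast approximating subsequence**: along an approximating sequence `Hₙ → σ`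
(`SimpleProcess.IsApproxSeq`) one can pick indices `φ k ≥ k` with
`P {1/(k+1)³ ≤ ∫₀ᵏ (H_{φ k} - σ)²} ≤ 1/(k+1)` (diagonal choice). [folklore] -/
theorem exists_fast_isApproxSeq {H : ℕ → SimpleProcess m 𝓕} {σ : ℝ≥0 → Ω → ℝ}
    (hH : SimpleProcess.IsApproxSeq H σ P) :
    ∃ φ : ℕ → ℕ, (∀ k, k ≤ φ k) ∧ ∀ k : ℕ,
      P {ω | ENNReal.ofReal (1 / ((k : ℝ) + 1) ^ 3) ≤ ∫⁻ s in Set.Icc (0 : ℝ) (k : ℝ≥0),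
        ENNReal.ofReal (((H (φ k)).toProcess s.toNNReal ω - σ s.toNNReal ω) ^ 2)} ≤
        ENNReal.ofReal (1 / ((k : ℝ) + 1)) := by
  have hex : ∀ k : ℕ, ∃ N : ℕ, ∀ n ≥ N,
      P {ω | ENNReal.ofReal (1 / ((k : ℝ) + 1) ^ 3) ≤ ∫⁻ s in Set.Icc (0 : ℝ) (k : ℝ≥0),
        ENNReal.ofReal (((H n).toProcess s.toNNReal ω - σ s.toNNReal ω) ^ 2)} ≤
        ENNReal.ofReal (1 / ((k : ℝ) + 1)) := by
    intro k
    have h := hH (k : ℝ≥0) (1 / ((k : ℝ) + 1) ^ 3) (by positivity)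
    rw [ENNReal.tendsto_nhds_zero] at h
    exact eventually_atTop.1 (h _ (ENNReal.ofReal_pos.2 (by positivity)))
  choose N hN using hex
  exact ⟨fun k ↦ max k (N k), fun k ↦ le_max_left _ _, fun k ↦ hN k _ (le_max_right _ _)⟩

/-- **The approximating sequence of `σ Z`.** Let `Hₙ → σ` be an approximating sequence with a fast
subsequence `H_{φ k}` (`exists_fast_isApproxSeq`), `σ` jointly measurable with `∫₀ᵗ σ² < ∞`
a.s., and `Z` an adapted, jointly measurable process with a.s. continuous paths. Then the
products `Γₖ H_{φ k}` of the dyadically sampled (and clamped) `Z` (`SimpleProcess.sample Z _ k`)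
with `H_{φ k}` form an approximating sequence of the integrand `σ Z`:
`∫₀ᵀ (Γₖ H_{φ k} - σ Z)² ≤ 2 k² ∫₀ᵀ (H_{φ k} - σ)² + 2 ∫₀ᵀ (Γₖ - Z)² σ²`, the first term is
small by the fast choice and the second a.s. by uniform continuity of the path of `Z`.
Revuz–Yor, *Continuous Martingales and Brownian Motion* (1999), Ch. IV, Prop. (2.13) (proof) and
Prop. (2.4); Le Gall (2016), Prop. 5.9. [folklore] -/
theorem isApproxSeq_sample_mul [IsFiniteMeasure P] {H : ℕ → SimpleProcess m 𝓕}
    {σ Z : ℝ≥0 → Ω → ℝ} (hσj : Measurable fun p : Ω × ℝ ↦ σ p.2.toNNReal p.1)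
    (hZj : Measurable fun p : Ω × ℝ ↦ Z p.2.toNNReal p.1) (hZa : Adapted 𝓕 Z)
    (hZc : ∀ᵐ ω ∂P, Continuous (Z · ω))
    (hfin : ∀ᵐ ω ∂P, ∀ t : ℝ≥0, ∫⁻ s in Set.Icc (0 : ℝ) t, ENNReal.ofReal (σ s.toNNReal ω ^ 2) < ∞)
    {φ : ℕ → ℕ}
    (hφH : ∀ k : ℕ, P {ω | ENNReal.ofReal (1 / ((k : ℝ) + 1) ^ 3) ≤
      ∫⁻ s in Set.Icc (0 : ℝ) (k : ℝ≥0),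
        ENNReal.ofReal (((H (φ k)).toProcess s.toNNReal ω - σ s.toNNReal ω) ^ 2)} ≤
        ENNReal.ofReal (1 / ((k : ℝ) + 1))) :
    SimpleProcess.IsApproxSeq (fun k ↦ (SimpleProcess.sample Z hZa k).mul (H (φ k)))
      (fun s ω ↦ σ s ω * Z s ω) P := by
  intro T ε hε
  -- the two error integrals
  set I₁ : ℕ → Ω → ℝ≥0∞ := fun k ω ↦ ∫⁻ s in Set.Icc (0 : ℝ) T,
    ENNReal.ofReal (((H (φ k)).toProcess s.toNNReal ω - σ s.toNNReal ω) ^ 2) with hI₁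
  set I₂ : ℕ → Ω → ℝ≥0∞ := fun k ω ↦ ∫⁻ s in Set.Icc (0 : ℝ) T,
    ENNReal.ofReal (((SimpleProcess.sample Z hZa k).toProcess s.toNNReal ω - Z s.toNNReal ω) ^ 2 *
      σ s.toNNReal ω ^ 2) with hI₂
  -- Step 1: the pointwise splitting of the error
  have hsplit : ∀ k ω, ∫⁻ s in Set.Icc (0 : ℝ) T, ENNReal.ofReal
      ((((SimpleProcess.sample Z hZa k).mul (H (φ k))).toProcess s.toNNReal ω -
        σ s.toNNReal ω * Z s.toNNReal ω) ^ 2) ≤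
      2 * ENNReal.ofReal ((k : ℝ) ^ 2) * I₁ k ω + 2 * I₂ k ω := by
    intro k ω
    have hσω : Measurable fun s : ℝ ↦ σ s.toNNReal ω := hσj.comp measurable_prodMk_left
    have hHω : Measurable fun s : ℝ ↦ (H (φ k)).toProcess s.toNNReal ω :=
      (H (φ k)).measurable_toProcess_prod.comp measurable_prodMk_left
    have hm1 : Measurable fun s : ℝ ↦ 2 * ENNReal.ofReal ((k : ℝ) ^ 2) *
        ENNReal.ofReal (((H (φ k)).toProcess s.toNNReal ω - σ s.toNNReal ω) ^ 2) :=
      (((hHω.sub hσω).pow_const 2).ennreal_ofReal).const_mul _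
    have hΓ : ∀ s : ℝ≥0, |(SimpleProcess.sample Z hZa k).toProcess s ω| ≤ k := by
      intro s
      have := (SimpleProcess.sample Z hZa k).abs_toProcess_le (C := k)
        (fun i ω ↦ by rw [SimpleProcess.sample_value]; exact (abs_clamp_le _ _).trans (by simp)) s ω
      simpa using this
    calc ∫⁻ s in Set.Icc (0 : ℝ) T, ENNReal.ofReal
          ((((SimpleProcess.sample Z hZa k).mul (H (φ k))).toProcess s.toNNReal ω -
            σ s.toNNReal ω * Z s.toNNReal ω) ^ 2)
        ≤ ∫⁻ s in Set.Icc (0 : ℝ) T, (2 * ENNReal.ofReal ((k : ℝ) ^ 2) *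
            ENNReal.ofReal (((H (φ k)).toProcess s.toNNReal ω - σ s.toNNReal ω) ^ 2) +
            2 * ENNReal.ofReal (((SimpleProcess.sample Z hZa k).toProcess s.toNNReal ω -
              Z s.toNNReal ω) ^ 2 * σ s.toNNReal ω ^ 2)) := by
          refine lintegral_mono fun s ↦ ?_
          rw [SimpleProcess.toProcess_mul]
          set Γ := (SimpleProcess.sample Z hZa k).toProcess s.toNNReal ω
          set h := (H (φ k)).toProcess s.toNNReal ω
          set z := Z s.toNNReal ω
          set σ' := σ s.toNNReal ω
          have hdec : Γ * h - σ' * z = Γ * (h - σ') + (Γ - z) * σ' := by ring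
          rw [hdec]
          have hΓk : Γ ^ 2 ≤ (k : ℝ) ^ 2 := by
            rw [← sq_abs]; exact pow_le_pow_left₀ (abs_nonneg _) (hΓ _) 2
          calc ENNReal.ofReal ((Γ * (h - σ') + (Γ - z) * σ') ^ 2)
              ≤ ENNReal.ofReal (2 * ((k : ℝ) ^ 2 * (h - σ') ^ 2) + 2 * ((Γ - z) ^ 2 * σ' ^ 2)) := by
                refine ENNReal.ofReal_le_ofReal ?_
                have h1 : (Γ * (h - σ') + (Γ - z) * σ') ^ 2 ≤
                    2 * (Γ * (h - σ')) ^ 2 + 2 * ((Γ - z) * σ') ^ 2 := by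
                  nlinarith [sq_nonneg (Γ * (h - σ') - (Γ - z) * σ')]
                have h2 : (Γ * (h - σ')) ^ 2 ≤ (k : ℝ) ^ 2 * (h - σ') ^ 2 := by
                  rw [mul_pow]; exact mul_le_mul_of_nonneg_right hΓk (sq_nonneg _)
                nlinarith [mul_pow (Γ - z) σ' 2]
            _ = 2 * ENNReal.ofReal ((k : ℝ) ^ 2) * ENNReal.ofReal ((h - σ') ^ 2) +
                2 * ENNReal.ofReal ((Γ - z) ^ 2 * σ' ^ 2) := by
                rw [ENNReal.ofReal_add (by positivity) (by positivity),
                  ENNReal.ofReal_mul zero_le_two, ENNReal.ofReal_mul (by positivity),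
                  ENNReal.ofReal_mul zero_le_two, ENNReal.ofReal_ofNat, mul_assoc]
      _ = 2 * ENNReal.ofReal ((k : ℝ) ^ 2) * I₁ k ω + 2 * I₂ k ω := by
          have hm0 : Measurable fun s : ℝ ↦
              ENNReal.ofReal (((H (φ k)).toProcess s.toNNReal ω - σ s.toNNReal ω) ^ 2) :=
            ((hHω.sub hσω).pow_const 2).ennreal_ofReal
          rw [lintegral_add_left hm1, lintegral_const_mul _ hm0,
            lintegral_const_mul' _ _ ENNReal.ofNat_ne_top]
  -- Step 2: the event is covered by two events
  have hε2 : 0 < ε / 2 := half_pos hε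
  have hcover : ∀ k, {ω | ENNReal.ofReal ε ≤ ∫⁻ s in Set.Icc (0 : ℝ) T, ENNReal.ofReal
      ((((SimpleProcess.sample Z hZa k).mul (H (φ k))).toProcess s.toNNReal ω -
        σ s.toNNReal ω * Z s.toNNReal ω) ^ 2)} ⊆
      {ω | ENNReal.ofReal (ε / 2) ≤ 2 * ENNReal.ofReal ((k : ℝ) ^ 2) * I₁ k ω} ∪
        {ω | ENNReal.ofReal (ε / 2) ≤ 2 * I₂ k ω} := by
    intro k ω hω
    by_contra hcon
    simp only [Set.mem_union, Set.mem_setOf_eq, not_or, not_le] at hcon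
    have := (hsplit k ω).trans_lt (ENNReal.add_lt_add hcon.1 hcon.2)
    rw [← ENNReal.ofReal_add hε2.le hε2.le, add_halves] at this
    exact absurd hω (not_le.2 this)
  -- Step 3: the first event
  have hfirst : Tendsto (fun k : ℕ ↦ P {ω | ENNReal.ofReal (ε / 2) ≤
      2 * ENNReal.ofReal ((k : ℝ) ^ 2) * I₁ k ω}) atTop (𝓝 0) := by
    -- eventually `T ≤ k` and `2 k² / (k+1)³ < ε / 2`
    have hrate : Tendsto (fun k : ℕ ↦ 2 * (k : ℝ) ^ 2 * (1 / ((k : ℝ) + 1) ^ 3)) atTop (𝓝 0) := by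
      have h1 : Tendsto (fun k : ℕ ↦ 2 * (1 / ((k : ℝ) + 1))) atTop (𝓝 (2 * 0)) :=
        tendsto_one_div_add_atTop_nhds_zero_nat.const_mul 2
      rw [mul_zero] at h1
      refine squeeze_zero (fun k ↦ by positivity) (fun k ↦ ?_) h1
      have hk1 : (0 : ℝ) < (k : ℝ) + 1 := by positivity
      have key : (k : ℝ) ^ 2 * (1 / ((k : ℝ) + 1) ^ 3) ≤ 1 / ((k : ℝ) + 1) := by
        rw [mul_one_div, div_le_div_iff₀ (by positivity) hk1, one_mul]
        nlinarith [sq_nonneg (k : ℝ)]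
      calc 2 * (k : ℝ) ^ 2 * (1 / ((k : ℝ) + 1) ^ 3) = 2 * ((k : ℝ) ^ 2 * (1 / ((k : ℝ) + 1) ^ 3)) := by
            ring
        _ ≤ 2 * (1 / ((k : ℝ) + 1)) := by gcongr
    have hev1 : ∀ᶠ k : ℕ in atTop, 2 * (k : ℝ) ^ 2 * (1 / ((k : ℝ) + 1) ^ 3) < ε / 2 :=
      (tendsto_order.1 hrate).2 _ hε2
    have hev2 : ∀ᶠ k : ℕ in atTop, (T : ℝ) ≤ k := tendsto_natCast_atTop_atTop.eventually_ge_atTop _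
    have hbound : Tendsto (fun k : ℕ ↦ ENNReal.ofReal (1 / ((k : ℝ) + 1))) atTop (𝓝 0) := by
      rw [← ENNReal.ofReal_zero]
      exact ENNReal.tendsto_ofReal tendsto_one_div_add_atTop_nhds_zero_nat
    refine tendsto_of_tendsto_of_tendsto_of_le_of_le' tendsto_const_nhds hbound
      (Eventually.of_forall fun k ↦ bot_le) ?_
    filter_upwards [hev1, hev2] with k hk1 hk2
    refine (measure_mono fun ω hω ↦ ?_).trans (hφH k)
    -- on the complement of the fast event the first error is `< ε/2`
    simp only [Set.mem_setOf_eq] at hω ⊢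
    by_contra hcon
    push Not at hcon
    have hI : I₁ k ω ≤ ∫⁻ s in Set.Icc (0 : ℝ) (k : ℝ≥0),
        ENNReal.ofReal (((H (φ k)).toProcess s.toNNReal ω - σ s.toNNReal ω) ^ 2) :=
      lintegral_mono_set (Set.Icc_subset_Icc le_rfl (by exact_mod_cast hk2))
    have : 2 * ENNReal.ofReal ((k : ℝ) ^ 2) * I₁ k ω < ENNReal.ofReal (ε / 2) :=
      calc 2 * ENNReal.ofReal ((k : ℝ) ^ 2) * I₁ k ω
          ≤ 2 * ENNReal.ofReal ((k : ℝ) ^ 2) * ENNReal.ofReal (1 / ((k : ℝ) + 1) ^ 3) := by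
            gcongr; exact hI.trans hcon.le
        _ = ENNReal.ofReal (2 * (k : ℝ) ^ 2 * (1 / ((k : ℝ) + 1) ^ 3)) := by
            rw [ENNReal.ofReal_mul (by positivity), ENNReal.ofReal_mul zero_le_two,
              ENNReal.ofReal_ofNat]
        _ < ENNReal.ofReal (ε / 2) := (ENNReal.ofReal_lt_ofReal_iff hε2).2 hk1
    exact absurd hω (not_le.2 this)
  -- Step 4: the second event, almost surely eventually impossible
  have hmeasI₂ : ∀ k, Measurable (I₂ k) := by
    intro k
    refine Measurable.lintegral_prod_right' (ν := volume.restrict (Set.Icc (0 : ℝ) T))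
      (f := fun p : Ω × ℝ ↦ ENNReal.ofReal
      (((SimpleProcess.sample Z hZa k).toProcess p.2.toNNReal p.1 - Z p.2.toNNReal p.1) ^ 2 *
        σ p.2.toNNReal p.1 ^ 2)) ?_
    exact ((((SimpleProcess.sample Z hZa k).measurable_toProcess_prod.sub hZj).pow_const 2).mul
      (hσj.pow_const 2)).ennreal_ofReal
  have hsecond : Tendsto (fun k : ℕ ↦ P {ω | ENNReal.ofReal (ε / 2) ≤ 2 * I₂ k ω}) atTop (𝓝 0) := by
    refine tendsto_measure_of_ae_eventually_notMem
      (fun k ↦ measurableSet_le measurable_const ((hmeasI₂ k).const_mul 2)) ?_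
    filter_upwards [hZc, hfin] with ω hωc hωfin
    -- the path data
    set S : ℝ≥0∞ := ∫⁻ s in Set.Icc (0 : ℝ) T, ENNReal.ofReal (σ s.toNNReal ω ^ 2) with hS
    have hStop : S ≠ ⊤ := (hωfin T).ne
    obtain ⟨θ, hθ, hθS⟩ : ∃ θ : ℝ, 0 < θ ∧ 2 * (ENNReal.ofReal (θ ^ 2) * S) < ENNReal.ofReal (ε / 2) := by
      set Sr : ℝ := S.toReal with hSr
      have hS0 : 0 ≤ Sr := ENNReal.toReal_nonneg
      have hSeq : S = ENNReal.ofReal Sr := (ENNReal.ofReal_toReal hStop).symm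
      refine ⟨Real.sqrt (ε / (8 * (Sr + 1))), Real.sqrt_pos.2 (by positivity), ?_⟩
      rw [Real.sq_sqrt (by positivity), hSeq, ← ENNReal.ofReal_mul (by positivity),
        ← ENNReal.ofReal_ofNat, ← ENNReal.ofReal_mul zero_le_two, ENNReal.ofReal_lt_ofReal_iff hε2]
      have h1 : ε / (8 * (Sr + 1)) * Sr ≤ ε / 8 := by
        rw [div_mul_eq_mul_div, div_le_div_iff₀ (by positivity) (by norm_num)]
        nlinarith
      nlinarith
    obtain ⟨M₀, hM₀⟩ := exists_forall_abs_le_of_continuous hωc T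
    obtain ⟨δ, hδ, hδZ⟩ := exists_forall_abs_sub_le_of_continuous hωc T hθ
    obtain ⟨k₁, hk₁⟩ := exists_pow_lt_of_lt_one hδ (by norm_num : (1 / 2 : ℝ) < 1)
    obtain ⟨k₂, hk₂⟩ := exists_nat_ge (max (T : ℝ) M₀)
    refine eventually_atTop.2 ⟨max k₁ k₂, fun k hk ↦ ?_⟩
    have hkT : (T : ℝ) ≤ k := (le_max_left _ _).trans (hk₂.trans (by exact_mod_cast (le_max_right _ _).trans hk))
    have hkM : M₀ ≤ k := (le_max_right _ _).trans (hk₂.trans (by exact_mod_cast (le_max_right _ _).trans hk))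
    have hkδ : (1 : ℝ) / 2 ^ k ≤ δ := by
      have : ((1 : ℝ) / 2) ^ k ≤ (1 / 2) ^ k₁ :=
        pow_le_pow_of_le_one (by norm_num) (by norm_num) ((le_max_left _ _).trans hk)
      rw [one_div, ← inv_pow, ← one_div]
      exact this.trans hk₁.le
    -- pointwise bound on `(0, T]`
    have hpt : ∀ s ∈ Set.Ioc (0 : ℝ) T, ENNReal.ofReal
        (((SimpleProcess.sample Z hZa k).toProcess s.toNNReal ω - Z s.toNNReal ω) ^ 2 *
          σ s.toNNReal ω ^ 2) ≤ ENNReal.ofReal (θ ^ 2) * ENNReal.ofReal (σ s.toNNReal ω ^ 2) := by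
      intro s hs
      have hs0 : 0 < s.toNNReal := Real.toNNReal_pos.2 hs.1
      have hsT : s.toNNReal ≤ T := Real.toNNReal_le_iff_le_coe.2 hs.2
      have hsk : s.toNNReal ≤ (k : ℝ≥0) := hsT.trans (by exact_mod_cast hkT)
      rw [SimpleProcess.toProcess_sample Z hZa hs0 hsk, ← ENNReal.ofReal_mul (sq_nonneg _)]
      refine ENNReal.ofReal_le_ofReal (mul_le_mul_of_nonneg_right ?_ (sq_nonneg _))
      have hleft := sampleLeft_le_and_sub_le (n := k) hs0
      have hL : sampleLeft k s.toNNReal ≤ T := hleft.1.trans hsT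
      rw [clamp_eq_self ((hM₀ _ hL).trans hkM), ← sq_abs]
      refine pow_le_pow_left₀ (abs_nonneg _) ?_ 2
      refine hδZ _ hL _ hsT ?_
      rw [abs_sub_comm, abs_of_nonneg (sub_nonneg.2 (NNReal.coe_le_coe.2 hleft.1))]
      exact hleft.2.trans hkδ
    have hI₂le : I₂ k ω ≤ ENNReal.ofReal (θ ^ 2) * S := by
      simp only [hI₂, hS]
      rw [← setLIntegral_congr Ioc_ae_eq_Icc, ← setLIntegral_congr Ioc_ae_eq_Icc,
        ← lintegral_const_mul' _ _ ENNReal.ofReal_ne_top]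
      exact setLIntegral_mono' measurableSet_Ioc hpt
    intro hmem
    have h2I : 2 * I₂ k ω ≤ 2 * (ENNReal.ofReal (θ ^ 2) * S) := by gcongr
    have : 2 * I₂ k ω < ENNReal.ofReal (ε / 2) := h2I.trans_lt hθS
    exact absurd hmem (not_le.2 this)
  -- Step 5: conclude
  have hsum := hfirst.add hsecond
  rw [add_zero] at hsum
  refine tendsto_of_tendsto_of_tendsto_of_le_of_le tendsto_const_nhds hsum (fun k ↦ bot_le)
    fun k ↦ (measure_mono (hcover k)).trans (measure_union_le _ _)

end Approx

/-! ### Quadratic sums of the error `J - Hₖ · B` -/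

section Canonical

variable {σ J : ℝ≥0 → (ℝ≥0 → ℝ) → ℝ}
  {H : ℕ → SimpleProcess (inferInstance : MeasurableSpace (ℝ≥0 → ℝ)) RandomPlanarGeometry.brownianFiltration}

/-- **Quadratic sums of the approximation error `J - Hₖ · B` are small in probability, uniformly
in the grid.** If `Hₙ → σ` (`IsApproxSeq`, `σ` jointly measurable) and `Hₙ · B → J` u.c.p., then
for every grid `u₀ ≤ ⋯ ≤ u_N ≤ t`, every `a, δ > 0` and every `k`,
`P {a ≤ ∑ᵢ (Δᵢ (J - Hₖ · B))²} ≤ P {δ/4 ≤ ∫₀ᵗ (Hₖ - σ)²} + 4δ/a`.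
Proof: `(Δ(J - HₖB))² ≤ 2 (Δ((H_{k'} - Hₖ) · B))² + 2 (Δ(J - H_{k'}B))²`; the first sum is bounded
in probability by `measure_quadSum_integral_ge_le_brownian` and `∫ (H_{k'} - Hₖ)² ≤ δ` off two
small events, the second by the u.c.p. convergence; then `k' → ∞`.
Revuz–Yor, *Continuous Martingales and Brownian Motion* (1999), Ch. IV, Thm (1.8) and
Thm (2.12). [folklore] -/
theorem measure_quadSum_err_ge_le (hσj : Measurable fun p : (ℝ≥0 → ℝ) × ℝ ↦ σ p.2.toNNReal p.1)
    (hH : SimpleProcess.IsApproxSeq H σ preWienerMeasure)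
    (hHJ : TendstoUCP (fun n ↦ (H n).integral brownian) J preWienerMeasure) (t : ℝ≥0)
    {u : ℕ → ℝ≥0} {N : ℕ} (hu : ∀ i < N, u i ≤ u (i + 1)) (huN : ∀ i ≤ N, u i ≤ t)
    {a δ : ℝ} (ha : 0 < a) (hδ : 0 < δ) (k : ℕ) :
    preWienerMeasure {ω | a ≤ ∑ i ∈ range N,
        ((J (u (i + 1)) ω - (H k).integral brownian (u (i + 1)) ω) -
          (J (u i) ω - (H k).integral brownian (u i) ω)) ^ 2} ≤
      preWienerMeasure {ω | ENNReal.ofReal (δ / 4) ≤ ∫⁻ s in Set.Icc (0 : ℝ) t,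
          ENNReal.ofReal (((H k).toProcess s.toNNReal ω - σ s.toNNReal ω) ^ 2)} +
        ENNReal.ofReal (4 * δ / a) := by
  haveI := RandomPlanarGeometry.isProbabilityMeasure_preWienerMeasure'
  -- notation
  set E : Set (ℝ≥0 → ℝ) := {ω | a ≤ ∑ i ∈ range N,
      ((J (u (i + 1)) ω - (H k).integral brownian (u (i + 1)) ω) -
        (J (u i) ω - (H k).integral brownian (u i) ω)) ^ 2} with hE
  set Bk : Set (ℝ≥0 → ℝ) := {ω | ENNReal.ofReal (δ / 4) ≤ ∫⁻ s in Set.Icc (0 : ℝ) t,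
      ENNReal.ofReal (((H k).toProcess s.toNNReal ω - σ s.toNNReal ω) ^ 2)} with hBk
  set Bk' : ℕ → Set (ℝ≥0 → ℝ) := fun k' ↦ {ω | ENNReal.ofReal (δ / 4) ≤ ∫⁻ s in Set.Icc (0 : ℝ) t,
      ENNReal.ofReal (((H k').toProcess s.toNNReal ω - σ s.toNNReal ω) ^ 2)} with hBk'
  -- the u.c.p. threshold
  have hθ : 0 < Real.sqrt (a / (4 * ((N : ℝ) + 1))) / 2 := by positivity
  set θ : ℝ := Real.sqrt (a / (4 * ((N : ℝ) + 1))) / 2 with hθdef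
  set Ck' : ℕ → Set (ℝ≥0 → ℝ) := fun k' ↦
    {ω | ∃ s ≤ t, θ ≤ |(H k').integral brownian s ω - J s ω|} with hCk'
  -- Step 1: for every `k'`, the event is covered
  have hcover : ∀ k', E ⊆ (Bk ∪ Bk' k' ∪ {ω | a / 4 ≤ ∑ i ∈ range N,
      (((H k').sub (H k)).integral brownian (u (i + 1)) ω -
        ((H k').sub (H k)).integral brownian (u i) ω) ^ 2} \ (Bk ∪ Bk' k')) ∪ Ck' k' := by
    intro k' ω hω
    by_cases hB : ω ∈ Bk ∪ Bk' k'
    · exact Or.inl (Or.inl hB)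
    by_cases hC : ω ∈ Ck' k'
    · exact Or.inr hC
    left; right
    refine ⟨?_, hB⟩
    -- on the complement of `Ck'`, the second quadratic sum is `< a/4`... so the first is `≥ a/4`
    simp only [hCk', Set.mem_setOf_eq, not_exists, not_and, not_le] at hC
    simp only [hE, Set.mem_setOf_eq] at hω ⊢
    -- per cell: `(Δe)² ≤ 2 (ΔD)² + 2 (Δe')²` and `|Δe'| ≤ 2θ`
    have hcell : ∀ i ∈ range N,
        ((J (u (i + 1)) ω - (H k).integral brownian (u (i + 1)) ω) -
          (J (u i) ω - (H k).integral brownian (u i) ω)) ^ 2 ≤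
        2 * (((H k').sub (H k)).integral brownian (u (i + 1)) ω -
          ((H k').sub (H k)).integral brownian (u i) ω) ^ 2 + 2 * (2 * θ) ^ 2 := by
      intro i hi
      have hiN := mem_range.1 hi
      rw [(H k').integral_sub (H k), (H k').integral_sub (H k)]
      have h1 := hC (u (i + 1)) (huN (i + 1) hiN)
      have h0 := hC (u i) (huN i hiN.le)
      rw [abs_lt] at h1 h0
      nlinarith [sq_nonneg ((J (u (i + 1)) ω - (H k).integral brownian (u (i + 1)) ω) -
          (J (u i) ω - (H k).integral brownian (u i) ω) -
          2 * ((H k').integral brownian (u (i + 1)) ω - (H k).integral brownian (u (i + 1)) ω -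
            ((H k').integral brownian (u i) ω - (H k).integral brownian (u i) ω))),
        sq_nonneg ((H k').integral brownian (u (i + 1)) ω - J (u (i + 1)) ω +
          ((H k').integral brownian (u i) ω - J (u i) ω)),
        sq_nonneg ((H k').integral brownian (u (i + 1)) ω - J (u (i + 1)) ω -
          ((H k').integral brownian (u i) ω - J (u i) ω))]
    have hsum := sum_le_sum hcell
    rw [sum_add_distrib, ← mul_sum] at hsum
    have hθ2 : ∑ i ∈ range N, 2 * (2 * θ) ^ 2 ≤ a / 2 := by
      rw [sum_const, card_range, nsmul_eq_mul]
      have hsq : θ ^ 2 = a / (4 * ((N : ℝ) + 1)) / 4 := by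
        rw [hθdef, div_pow, Real.sq_sqrt (by positivity)]; ring
      have : (N : ℝ) * (2 * (2 * θ) ^ 2) = 8 * N * θ ^ 2 := by ring
      rw [this, hsq]
      rw [show 8 * (N : ℝ) * (a / (4 * ((N : ℝ) + 1)) / 4) = a / 2 * ((N : ℝ) / ((N : ℝ) + 1)) by
        field_simp; ring]
      exact mul_le_of_le_one_right (by positivity) ((div_le_one (by positivity)).2 (by linarith))
    linarith [hω.trans hsum]
  -- Step 2: bound the pieces
  have hσω : ∀ ω : ℝ≥0 → ℝ, Measurable fun s : ℝ ↦ σ s.toNNReal ω := fun ω ↦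
    hσj.comp measurable_prodMk_left
  have hmid : ∀ k', preWienerMeasure ({ω | a / 4 ≤ ∑ i ∈ range N,
      (((H k').sub (H k)).integral brownian (u (i + 1)) ω -
        ((H k').sub (H k)).integral brownian (u i) ω) ^ 2} \ (Bk ∪ Bk' k')) ≤
      ENNReal.ofReal (4 * δ / a) := by
    intro k'
    have hA := measure_quadSum_integral_ge_le_brownian ((H k').sub (H k)) t hu (huN N le_rfl)
      (η := a / 4) (δ := δ) (by positivity) hδ
    -- the bad event of `H_{k'} - H_k` is inside `Bk ∪ Bk'`
    have hbad : {ω | δ < ∫ s in Set.Icc (0 : ℝ) t, (((H k').sub (H k)).toProcess s.toNNReal ω) ^ 2} ⊆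
        Bk ∪ Bk' k' := by
      intro ω hω
      by_contra hcon
      simp only [hBk, hBk', Set.mem_union, Set.mem_setOf_eq, not_or, not_le] at hcon
      exact absurd (setIntegral_toProcess_sub_sq_le (H k') (H k) (hσω ω) hδ.le t hcon.2 hcon.1)
        (not_le.2 hω)
    calc preWienerMeasure ({ω | a / 4 ≤ ∑ i ∈ range N,
          (((H k').sub (H k)).integral brownian (u (i + 1)) ω -
            ((H k').sub (H k)).integral brownian (u i) ω) ^ 2} \ (Bk ∪ Bk' k'))
        ≤ preWienerMeasure ({ω | a / 4 ≤ ∑ i ∈ range N,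
          (((H k').sub (H k)).integral brownian (u (i + 1)) ω -
            ((H k').sub (H k)).integral brownian (u i) ω) ^ 2} \
            {ω | δ < ∫ s in Set.Icc (0 : ℝ) t, (((H k').sub (H k)).toProcess s.toNNReal ω) ^ 2}) :=
          measure_mono fun ω hω ↦ ⟨hω.1, fun h ↦ hω.2 (hbad h)⟩
      _ ≤ ENNReal.ofReal (δ / (a / 4)) := hA
      _ = ENNReal.ofReal (4 * δ / a) := by rw [div_div_eq_mul_div, mul_comm]
  -- Step 3: let `k' → ∞`
  have hlim : Tendsto (fun k' ↦ preWienerMeasure (Bk' k') + preWienerMeasure (Ck' k')) atTop (𝓝 0) := by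
    have h1 := hH t (δ / 4) (by positivity)
    have h2 := hHJ t θ hθ
    simpa using h1.add h2
  have hbound : ∀ k', preWienerMeasure E ≤ (preWienerMeasure Bk + ENNReal.ofReal (4 * δ / a)) +
      (preWienerMeasure (Bk' k') + preWienerMeasure (Ck' k')) := by
    intro k'
    calc preWienerMeasure E ≤ preWienerMeasure (Bk ∪ Bk' k' ∪ ({ω | a / 4 ≤ ∑ i ∈ range N,
          (((H k').sub (H k)).integral brownian (u (i + 1)) ω -
            ((H k').sub (H k)).integral brownian (u i) ω) ^ 2} \ (Bk ∪ Bk' k'))) +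
          preWienerMeasure (Ck' k') := (measure_mono (hcover k')).trans (measure_union_le _ _)
      _ ≤ (preWienerMeasure Bk + preWienerMeasure (Bk' k') + ENNReal.ofReal (4 * δ / a)) +
          preWienerMeasure (Ck' k') := by
          gcongr
          exact (measure_union_le _ _).trans (add_le_add (measure_union_le _ _) (hmid k'))
      _ = _ := by ring_nf
  have := ge_of_tendsto' (tendsto_const_nhds.add hlim) hbound
  simpa using this

end Canonical

/-! ### Deterministic helpers for the quadratic-sum core -/

section Helpers

variable {Ω : Type*} {m : MeasurableSpace Ω} {𝓕 : Filtration ℝ≥0 m}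

/-- **The straddling cell.** For a simple process `R` whose partition starts at `0` and reaches
`t`, with capped cells `≤ δ`, and `r ≤ t`: the sum of `Rᵢ² Δᵢ` over the capped cells starting
before `r` differs from `∫_{[0,r]} R(s⁺)² ds` by at most `(max C 0)² δ` (only the cell straddling
`r` contributes). [folklore] -/
theorem SimpleProcess.abs_sum_indicator_sq_mul_sub_setIntegral_le (R : SimpleProcess m 𝓕) {C : ℝ}
    (hC : ∀ i ω, |R.value i ω| ≤ C) (t : ℝ≥0) {r : ℝ≥0} (hr : r ≤ t) {δ : ℝ} (hδ : 0 ≤ δ)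
    (hmesh : ∀ i, i + 1 < R.times.length →
      (((min t (R.time (i + 1))) : ℝ≥0) : ℝ) - (min t (R.time i) : ℝ≥0) ≤ δ) (ω : Ω) :
    |∑ i ∈ range (R.times.length - 1), (Set.Iio r).indicator (1 : ℝ≥0 → ℝ) (min t (R.time i)) *
        (R.value i ω ^ 2 * ((((min t (R.time (i + 1))) : ℝ≥0) : ℝ) - (min t (R.time i) : ℝ≥0))) -
      ∫ s in Set.Icc (0 : ℝ) r, (R.toProcess s.toNNReal ω) ^ 2| ≤ (max C 0) ^ 2 * δ := by
  rw [R.setIntegral_toProcess_sq r ω, ← sum_sub_distrib]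
  -- the per-cell discrepancy
  have hcell : ∀ i ∈ range (R.times.length - 1),
      (Set.Iio r).indicator (1 : ℝ≥0 → ℝ) (min t (R.time i)) *
          (R.value i ω ^ 2 * ((((min t (R.time (i + 1))) : ℝ≥0) : ℝ) - (min t (R.time i) : ℝ≥0))) -
        R.value i ω ^ 2 * ((((min r (R.time (i + 1))) : ℝ≥0) : ℝ) - (min r (R.time i) : ℝ≥0)) =
      R.value i ω ^ 2 * (if R.time i < r ∧ r < R.time (i + 1) then
        ((((min t (R.time (i + 1))) : ℝ≥0) : ℝ) - r) else 0) := by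
    intro i hi
    have hi' : i + 1 < R.times.length := by have := mem_range.1 hi; omega
    have hii : R.time i ≤ R.time (i + 1) := R.time_mono (Nat.le_succ i) hi'
    by_cases h1 : R.time i < r
    · have hti : min t (R.time i) = R.time i := min_eq_right (h1.le.trans hr)
      have hri : min r (R.time i) = R.time i := min_eq_right h1.le
      rw [hti, Set.indicator_of_mem (show R.time i ∈ Set.Iio r from h1), Pi.one_apply, one_mul, hri]
      by_cases h2 : r < R.time (i + 1)
      · rw [if_pos ⟨h1, h2⟩, min_eq_left h2.le]; ring
      · push Not at h2
        rw [if_neg (fun h ↦ (not_lt.2 h2) h.2), min_eq_right h2, min_eq_right (h2.trans hr)]; ring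
    · push Not at h1
      have hti : r ≤ min t (R.time i) := le_min hr h1
      rw [Set.indicator_of_notMem (show min t (R.time i) ∉ Set.Iio r from not_lt.2 hti), zero_mul,
        if_neg (fun h ↦ (not_lt.2 h1) h.1), min_eq_left h1, min_eq_left (h1.trans hii)]
      ring
  rw [sum_congr rfl hcell]
  -- at most one cell straddles `r`
  have hcard : ((range (R.times.length - 1)).filter
      (fun i ↦ R.time i < r ∧ r < R.time (i + 1))).card ≤ 1 := by
    refine Finset.card_le_one.2 fun i hi j hj ↦ ?_
    simp only [mem_filter, Finset.mem_range] at hi hj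
    have hij : R.time i < R.time (j + 1) := hi.2.1.trans hj.2.2
    have hji : R.time j < R.time (i + 1) := hj.2.1.trans hi.2.2
    rw [R.time_lt_time_iff (by omega) (by omega)] at hij hji
    omega
  calc |∑ i ∈ range (R.times.length - 1), R.value i ω ^ 2 *
        (if R.time i < r ∧ r < R.time (i + 1) then ((((min t (R.time (i + 1))) : ℝ≥0) : ℝ) - r) else 0)|
      ≤ ∑ i ∈ range (R.times.length - 1), |R.value i ω ^ 2 *
        (if R.time i < r ∧ r < R.time (i + 1) then ((((min t (R.time (i + 1))) : ℝ≥0) : ℝ) - r) else 0)| :=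
        abs_sum_le_sum_abs _ _
    _ ≤ ∑ i ∈ range (R.times.length - 1),
        (if R.time i < r ∧ r < R.time (i + 1) then (max C 0) ^ 2 * δ else 0) := by
        refine sum_le_sum fun i hi ↦ ?_
        have hi' : i + 1 < R.times.length := by have := mem_range.1 hi; omega
        split_ifs with h
        · rw [abs_mul, abs_of_nonneg (sq_nonneg _)]
          refine mul_le_mul ?_ ?_ (abs_nonneg _) (sq_nonneg _)
          · rw [← sq_abs]
            exact pow_le_pow_left₀ (abs_nonneg _) ((hC i ω).trans (le_max_left _ _)) 2
          · have hti : min t (R.time i) = R.time i := min_eq_right (h.1.le.trans hr)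
            have hm := hmesh i hi'
            rw [hti] at hm
            rw [abs_of_nonneg (sub_nonneg.2 (NNReal.coe_le_coe.2 (le_min hr h.2.le)))]
            have : ((R.time i : ℝ≥0) : ℝ) ≤ r := NNReal.coe_le_coe.2 h.1.le
            linarith
        · simp
    _ = ((range (R.times.length - 1)).filter (fun i ↦ R.time i < r ∧ r < R.time (i + 1))).card •
          ((max C 0) ^ 2 * δ) := by rw [← sum_filter, sum_const]
    _ ≤ 1 • ((max C 0) ^ 2 * δ) := by
        rw [nsmul_eq_mul, nsmul_eq_mul]
        exact mul_le_mul_of_nonneg_right (by exact_mod_cast hcard) (by positivity)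
    _ = (max C 0) ^ 2 * δ := one_nsmul _

/-- **`∫ f² ≈ ∫ g²` when `∫ (f - g)²` is small** (for square-integrable `f, g` on `[0, t]`): for
every `λ > 0` and `r ≤ t`,
`|∫_{[0,r]} f² - ∫_{[0,r]} g²| ≤ (1/(2λ) + λ) ∫_{[0,t]} (f - g)² + 4λ ∫_{[0,t]} g²`
(`|f² - g²| = |f - g| |f + g| ≤ (f - g)²/(2λ) + λ(f + g)²/2` and `(f + g)² ≤ 2(f - g)² + 8g²`).
[folklore] -/
theorem abs_setIntegral_sq_sub_sq_le {f g : ℝ → ℝ} {t : ℝ} (hf : Measurable f) (hg : Measurable g)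
    (hf2 : IntegrableOn (fun s ↦ f s ^ 2) (Set.Icc 0 t)) (hg2 : IntegrableOn (fun s ↦ g s ^ 2) (Set.Icc 0 t))
    {r : ℝ} (hr : r ≤ t) {lam : ℝ} (hlam : 0 < lam) :
    |(∫ s in Set.Icc 0 r, f s ^ 2) - ∫ s in Set.Icc 0 r, g s ^ 2| ≤
      (1 / (2 * lam) + lam) * (∫ s in Set.Icc 0 t, (f s - g s) ^ 2) +
        4 * lam * ∫ s in Set.Icc 0 t, g s ^ 2 := by
  have hsub : Set.Icc 0 r ⊆ Set.Icc 0 t := Set.Icc_subset_Icc le_rfl hr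
  have hfg2 : IntegrableOn (fun s ↦ (f s - g s) ^ 2) (Set.Icc 0 t) := by
    have h2 : IntegrableOn (fun s ↦ 2 * (f s ^ 2 + g s ^ 2)) (Set.Icc 0 t) := (hf2.add hg2).const_mul 2
    refine h2.mono' ((hf.sub hg).pow_const 2).aestronglyMeasurable (ae_of_all _ fun s ↦ ?_)
    rw [Real.norm_eq_abs, abs_of_nonneg (sq_nonneg _)]
    nlinarith [sq_nonneg (f s + g s)]
  have hdiff : IntegrableOn (fun s ↦ f s ^ 2 - g s ^ 2) (Set.Icc 0 r) :=
    (hf2.mono_set hsub).sub (hg2.mono_set hsub)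
  rw [← integral_sub (hf2.mono_set hsub) (hg2.mono_set hsub)]
  -- pointwise domination of `|f² - g²|`
  have hdom : ∀ s, |f s ^ 2 - g s ^ 2| ≤
      (1 / (2 * lam) + lam) * (f s - g s) ^ 2 + 4 * lam * g s ^ 2 := by
    intro s
    have h1 : |f s ^ 2 - g s ^ 2| = |f s - g s| * |f s + g s| := by
      rw [← abs_mul]; ring_nf
    rw [h1]
    have h2 : |f s - g s| * |f s + g s| ≤ (f s - g s) ^ 2 / (2 * lam) + lam * (f s + g s) ^ 2 / 2 := by
      have key : 0 ≤ (|f s - g s| - lam * |f s + g s|) ^ 2 := sq_nonneg _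
      rw [sub_sq, mul_pow, sq_abs, sq_abs] at key
      rw [div_add_div _ _ (by positivity) two_ne_zero, le_div_iff₀ (by positivity)]
      nlinarith [key, abs_nonneg (f s - g s), abs_nonneg (f s + g s)]
    have h3 : (f s + g s) ^ 2 ≤ 2 * (f s - g s) ^ 2 + 8 * g s ^ 2 := by
      nlinarith [sq_nonneg (f s - g s - 2 * g s), sq_nonneg (f s - 3 * g s)]
    calc |f s - g s| * |f s + g s| ≤ (f s - g s) ^ 2 / (2 * lam) + lam * (f s + g s) ^ 2 / 2 := h2
      _ ≤ (f s - g s) ^ 2 / (2 * lam) + lam * (2 * (f s - g s) ^ 2 + 8 * g s ^ 2) / 2 := by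
          gcongr
      _ = (1 / (2 * lam) + lam) * (f s - g s) ^ 2 + 4 * lam * g s ^ 2 := by ring
  calc |∫ s in Set.Icc 0 r, (f s ^ 2 - g s ^ 2)|
      ≤ ∫ s in Set.Icc 0 r, |f s ^ 2 - g s ^ 2| := by
        rw [← Real.norm_eq_abs]; exact norm_integral_le_integral_norm _
    _ ≤ ∫ s in Set.Icc 0 r, ((1 / (2 * lam) + lam) * (f s - g s) ^ 2 + 4 * lam * g s ^ 2) :=
        integral_mono_of_nonneg (ae_of_all _ fun s ↦ abs_nonneg _)
          (((hfg2.mono_set hsub).const_mul _).add ((hg2.mono_set hsub).const_mul _))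
          (ae_of_all _ hdom)
    _ ≤ ∫ s in Set.Icc 0 t, ((1 / (2 * lam) + lam) * (f s - g s) ^ 2 + 4 * lam * g s ^ 2) :=
        setIntegral_mono_set ((hfg2.const_mul _).add (hg2.const_mul _))
          (ae_of_all _ fun s ↦ by positivity) (ae_of_all _ hsub)
    _ = (1 / (2 * lam) + lam) * (∫ s in Set.Icc 0 t, (f s - g s) ^ 2) +
        4 * lam * ∫ s in Set.Icc 0 t, g s ^ 2 := by
        rw [integral_add (hfg2.const_mul _) (hg2.const_mul _), MeasureTheory.integral_const_mul,
          MeasureTheory.integral_const_mul]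

end Helpers

/-- **`∫₀ᵗ σ² ds` is a.s. finite, quantitatively**: `P {L ≤ ∫₀ᵗ σ²} ≤ ε` for some level `L`
(continuity from above along the measurable events). [folklore] -/
theorem exists_measure_lintegral_sq_ge_le {Ω : Type*} {m : MeasurableSpace Ω} {P : Measure Ω}
    [IsFiniteMeasure P] {σ : ℝ≥0 → Ω → ℝ} (hσj : Measurable fun p : Ω × ℝ ↦ σ p.2.toNNReal p.1)
    (t : ℝ≥0) (hfin : ∀ᵐ ω ∂P, ∫⁻ s in Set.Icc (0 : ℝ) t, ENNReal.ofReal (σ s.toNNReal ω ^ 2) < ∞)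
    {ε : ℝ≥0∞} (hε : 0 < ε) :
    ∃ L : ℕ, P {ω | (L : ℝ≥0∞) ≤ ∫⁻ s in Set.Icc (0 : ℝ) t, ENNReal.ofReal (σ s.toNNReal ω ^ 2)} ≤ ε := by
  have hImeas : Measurable fun ω ↦ ∫⁻ s in Set.Icc (0 : ℝ) t, ENNReal.ofReal (σ s.toNNReal ω ^ 2) :=
    ((hσj.pow_const 2).ennreal_ofReal).lintegral_prod_right'
      (ν := volume.restrict (Set.Icc (0 : ℝ) t))
  have hanti : Antitone fun M : ℕ ↦ {ω | (M : ℝ≥0∞) ≤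
      ∫⁻ s in Set.Icc (0 : ℝ) t, ENNReal.ofReal (σ s.toNNReal ω ^ 2)} :=
    fun M M' hMM' ω (hω : (M' : ℝ≥0∞) ≤ _) ↦ (show (M : ℝ≥0∞) ≤ M' by exact_mod_cast hMM').trans hω
  have hnull : P (⋂ M : ℕ, {ω | (M : ℝ≥0∞) ≤
      ∫⁻ s in Set.Icc (0 : ℝ) t, ENNReal.ofReal (σ s.toNNReal ω ^ 2)}) = 0 := by
    rw [measure_eq_zero_iff_ae_notMem]
    filter_upwards [hfin] with ω hω hmem
    simp only [Set.mem_iInter, Set.mem_setOf_eq] at hmem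
    obtain ⟨M, hM⟩ := ENNReal.exists_nat_gt hω.ne
    exact absurd (hmem M) (not_le.2 hM)
  have hlim := tendsto_measure_iInter_atTop (μ := P)
    (fun M ↦ (measurableSet_le measurable_const hImeas).nullMeasurableSet) hanti ⟨0, measure_ne_top _ _⟩
  rw [hnull] at hlim
  exact (ENNReal.tendsto_nhds_zero.1 hlim ε hε).exists

/-! ### CORE 2: quadratic sums of `J` over the cells starting before `r` -/

section Core

variable {σ J : ℝ≥0 → (ℝ≥0 → ℝ) → ℝ}
  {H : ℕ → SimpleProcess (inferInstance : MeasurableSpace (ℝ≥0 → ℝ)) RandomPlanarGeometry.brownianFiltration}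

/-- Bounded step paths are square integrable on `[0, t]`. [folklore] -/
theorem SimpleProcess.integrableOn_toProcess_sq_real
    (R : SimpleProcess (inferInstance : MeasurableSpace (ℝ≥0 → ℝ)) RandomPlanarGeometry.brownianFiltration) (t : ℝ)
    (ω : ℝ≥0 → ℝ) : IntegrableOn (fun s : ℝ ↦ (R.toProcess s.toNNReal ω) ^ 2) (Set.Icc 0 t) := by
  obtain ⟨C, hC⟩ := R.bounded
  refine Measure.integrableOn_of_bounded (M := (max C 0) ^ 2) measure_Icc_lt_top.ne
    ((R.measurable_toProcess_prod.comp measurable_prodMk_left).pow_const 2).aestronglyMeasurable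
    (ae_of_all _ fun s ↦ ?_)
  rw [Real.norm_eq_abs, abs_of_nonneg (sq_nonneg _), ← sq_abs]
  exact pow_le_pow_left₀ (abs_nonneg _) (R.abs_toProcess_le hC _ ω) 2

/-- **CORE 2 — quadratic sums of the Itô integral over the cells starting before `r`.** Let
`Hₙ → σ` be an approximating sequence (`σ` jointly measurable, `∫₀ᵗ σ² < ∞` a.s.) with
`Hₙ · B → J` u.c.p. For the grids `u = (t ∧ vᵢ)ᵢ` of the refinements `(H k).gridRefine t n`,
`r ≤ t` and `η, ε > 0`: for `k ≥ K₀` and then `n ≥ N₀(k)`,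
`P {η ≤ |∑_{uᵢ < r} (J_{uᵢ₊₁} - J_{uᵢ})² - ∫₀ʳ σ² ds|} ≤ ε`.
Proof: `J ≈ Hₖ · B` in quadratic sums (`measure_quadSum_err_ge_le`, Cauchy–Schwarz and
`measure_quadSum_integral_ge_le_brownian`), `∑ wᵢ (Δᵢ(Hₖ · B))² ≈ ∑ wᵢ Hₖᵢ² Δᵢ`
(`measure_weightedQuadSum_sub_ge_le`, `n → ∞`), which is `∫₀ʳ Hₖ²` up to the straddling cell,
and `∫₀ʳ Hₖ² ≈ ∫₀ʳ σ²` (`abs_setIntegral_sq_sub_sq_le`, `k → ∞`).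
Le Gall (2016), Prop. 4.21 and proof of Thm 5.10; Revuz–Yor (1999), Ch. IV, Thm (1.8),
Thm (2.2) (`⟨K·M⟩ = K²·⟨M⟩`), Thm (2.12). [folklore] -/
theorem exists_forall_measure_quadSum_sub_ge_le
    (hσj : Measurable fun p : (ℝ≥0 → ℝ) × ℝ ↦ σ p.2.toNNReal p.1)
    (hH : SimpleProcess.IsApproxSeq H σ preWienerMeasure)
    (hHJ : TendstoUCP (fun n ↦ (H n).integral brownian) J preWienerMeasure)
    (hfin : ∀ᵐ ω ∂preWienerMeasure, ∀ t : ℝ≥0,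
      ∫⁻ s in Set.Icc (0 : ℝ) t, ENNReal.ofReal (σ s.toNNReal ω ^ 2) < ∞)
    (t : ℝ≥0) {r : ℝ≥0} (hr : r ≤ t) {η : ℝ} (hη : 0 < η) {ε : ℝ} (hε : 0 < ε) :
    ∃ K₀ : ℕ, ∃ N₀ : ℕ → ℕ, ∀ k ≥ K₀, ∀ n ≥ N₀ k,
      preWienerMeasure {ω | η ≤ |∑ i ∈ range (((H k).gridRefine t n).times.length - 1),
          (Set.Iio r).indicator (1 : ℝ≥0 → ℝ) (min t (((H k).gridRefine t n).time i)) *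
            (J (min t (((H k).gridRefine t n).time (i + 1))) ω -
              J (min t (((H k).gridRefine t n).time i)) ω) ^ 2 -
          ∫ s in (0 : ℝ)..(r : ℝ), σ s.toNNReal ω ^ 2|} ≤ ENNReal.ofReal ε := by
  haveI := RandomPlanarGeometry.isProbabilityMeasure_preWienerMeasure'
  have hε8 : 0 < ε / 8 := by positivity
  have hε8' : (0 : ℝ≥0∞) < ENNReal.ofReal (ε / 8) := ENNReal.ofReal_pos.2 hε8
  -- Step A: constants independent of `k, n`
  -- (i) `∫₀ᵗ Hₖ²` bounded in probability
  obtain ⟨L₁, hL₁⟩ := exists_forall_measure_setIntegral_sq_gt_le (P := preWienerMeasure) hσj hH t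
    (by filter_upwards [hfin] with ω hω using hω t) hε8'
  set L₁' : ℝ := max L₁ 1 with hL₁'
  have hL₁'pos : 0 < L₁' := lt_of_lt_of_le one_pos (le_max_right _ _)
  have hL₁'' : ∀ k, preWienerMeasure {ω | L₁' < ∫ s in Set.Icc (0 : ℝ) t,
      ((H k).toProcess s.toNNReal ω) ^ 2} ≤ ENNReal.ofReal (ε / 8) := fun k ↦
    (measure_mono fun ω (hω : L₁' < _) ↦ lt_of_le_of_lt (le_max_left _ _) hω).trans (hL₁ k)
  -- (ii) the Cauchy–Schwarz thresholds
  set b : ℝ := 128 * L₁' / ε with hb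
  have hbpos : 0 < b := by positivity
  set a : ℝ := (η / 3) ^ 2 / b with ha
  have hapos : 0 < a := by positivity
  set amin : ℝ := min a (b / 4) with hamin
  have haminpos : 0 < amin := lt_min hapos (by positivity)
  set δ' : ℝ := amin * ε / 32 with hδ'
  have hδ'pos : 0 < δ' := by positivity
  -- (iii) `k`-thresholds from the approximation property
  have hA1 := hH t (δ' / 4) (by positivity)
  rw [ENNReal.tendsto_nhds_zero] at hA1
  obtain ⟨K₁, hK₁⟩ := eventually_atTop.1 (hA1 _ hε8')
  obtain ⟨L, hL⟩ := exists_measure_lintegral_sq_ge_le (P := preWienerMeasure) hσj t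
    (by filter_upwards [hfin] with ω hω using hω t) hε8'
  set θ : ℝ := η / 6 with hθ
  have hθpos : 0 < θ := by positivity
  set lam : ℝ := θ / (8 * L + 8) with hlam
  have hlampos : 0 < lam := by positivity
  set κ : ℝ := (θ / 2) / (1 / (2 * lam) + lam) with hκ
  have hκpos : 0 < κ := by positivity
  have hA2 := hH t κ hκpos
  rw [ENNReal.tendsto_nhds_zero] at hA2
  obtain ⟨K₂, hK₂⟩ := eventually_atTop.1 (hA2 _ hε8')
  -- Step B: `n`-thresholds, depending on the bound of `H k` (for every `k`)
  have hmesh0 : Tendsto (fun n : ℕ ↦ (t : ℝ) / 2 ^ n) atTop (𝓝 0) := by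
    have := (tendsto_pow_atTop_nhds_zero_of_lt_one (r := (1 / 2 : ℝ)) (by norm_num) (by norm_num)).const_mul (t : ℝ)
    rw [mul_zero] at this
    refine this.congr fun n ↦ ?_
    rw [one_div, inv_pow, div_eq_mul_inv]
  have hNk : ∀ k, ∃ N₀, ∀ n ≥ N₀,
      2 * (max (Classical.choose (H k).bounded) 0) ^ 4 * ((t : ℝ) / 2 ^ n) * t / (η / 3) ^ 2 ≤ ε / 8 ∧
      (max (Classical.choose (H k).bounded) 0) ^ 2 * ((t : ℝ) / 2 ^ n) < θ := by
    intro k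
    set C' : ℝ := max (Classical.choose (H k).bounded) 0 with hC'
    have hev1 : ∀ᶠ n : ℕ in atTop, 2 * C' ^ 4 * ((t : ℝ) / 2 ^ n) * t / (η / 3) ^ 2 ≤ ε / 8 := by
      have : Tendsto (fun n : ℕ ↦ 2 * C' ^ 4 * ((t : ℝ) / 2 ^ n) * t / (η / 3) ^ 2) atTop (𝓝 0) := by
        have := ((hmesh0.const_mul (2 * C' ^ 4)).mul_const (t : ℝ)).div_const ((η / 3) ^ 2)
        simpa using this
      exact (this.eventually (ge_mem_nhds hε8)).mono fun n hn ↦ hn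
    have hev2 : ∀ᶠ n : ℕ in atTop, C' ^ 2 * ((t : ℝ) / 2 ^ n) < θ := by
      have : Tendsto (fun n : ℕ ↦ C' ^ 2 * ((t : ℝ) / 2 ^ n)) atTop (𝓝 0) := by
        simpa using hmesh0.const_mul (C' ^ 2)
      exact this.eventually (gt_mem_nhds hθpos)
    exact eventually_atTop.1 (hev1.and hev2)
  choose Nf hNf using hNk
  refine ⟨max K₁ K₂, Nf, fun k hk n hn ↦ ?_⟩
  have hk1 : K₁ ≤ k := (le_max_left _ _).trans hk
  have hk2 : K₂ ≤ k := (le_max_right _ _).trans hk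
  set C : ℝ := Classical.choose (H k).bounded
  have hC : ∀ i ω, |(H k).value i ω| ≤ C := Classical.choose_spec (H k).bounded
  set C' : ℝ := max C 0 with hC'
  obtain ⟨hn1, hn2⟩ := hNf k n hn
  -- Step C: notation for the grid
  set R := (H k).gridRefine t n with hR
  set Nc : ℕ := R.times.length - 1 with hNc
  set u : ℕ → ℝ≥0 := fun i ↦ min t (R.time i) with hu
  have humono : ∀ i < Nc, u i ≤ u (i + 1) := fun i hi ↦
    min_le_min_left _ (R.time_mono (Nat.le_succ i) (by omega))
  have hut : ∀ i ≤ Nc, u i ≤ t := fun i _ ↦ min_le_left _ _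
  have hmesh : ∀ i, i + 1 < R.times.length →
      (((min t (R.time (i + 1))) : ℝ≥0) : ℝ) - (min t (R.time i) : ℝ≥0) ≤ (t : ℝ) / 2 ^ n :=
    fun i hi ↦ (H k).gridRefine_cappedCell_le t n hi
  have hCR : ∀ i ω, |R.value i ω| ≤ C' := fun i ω ↦ (H k).abs_gridRefine_value_le t n hC i ω
  have hRint : ∀ s ω, R.integral brownian s ω = (H k).integral brownian s ω :=
    fun s ω ↦ (H k).integral_gridRefine t n brownian s ω
  have hRproc : ∀ s ω, R.toProcess s ω = (H k).toProcess s ω :=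
    fun s ω ↦ (H k).toProcess_gridRefine t n s ω
  -- the four events
  set E1a : Set (ℝ≥0 → ℝ) := {ω | amin ≤ ∑ i ∈ range Nc,
      ((J (u (i + 1)) ω - (H k).integral brownian (u (i + 1)) ω) -
        (J (u i) ω - (H k).integral brownian (u i) ω)) ^ 2} with hE1a
  set E1b : Set (ℝ≥0 → ℝ) := {ω | b / 16 ≤ ∑ i ∈ range Nc,
      (R.integral brownian (u (i + 1)) ω - R.integral brownian (u i) ω) ^ 2} with hE1b
  set E2 : Set (ℝ≥0 → ℝ) := {ω | η / 3 ≤ |∑ i ∈ range Nc, (Set.Iio r).indicator (1 : ℝ≥0 → ℝ) (u i) *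
      ((R.integral brownian (min t (R.time (i + 1))) ω - R.integral brownian (min t (R.time i)) ω) ^ 2 -
        R.value i ω ^ 2 * ((((min t (R.time (i + 1))) : ℝ≥0) : ℝ) - (min t (R.time i) : ℝ≥0)))|}
    with hE2
  set E3 : Set (ℝ≥0 → ℝ) := {ω | ENNReal.ofReal κ ≤ ∫⁻ s in Set.Icc (0 : ℝ) t,
      ENNReal.ofReal (((H k).toProcess s.toNNReal ω - σ s.toNNReal ω) ^ 2)} ∪
      {ω | (L : ℝ≥0∞) ≤ ∫⁻ s in Set.Icc (0 : ℝ) t, ENNReal.ofReal (σ s.toNNReal ω ^ 2)} with hE3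
  -- Step D: the covering
  have hcover : {ω | η ≤ |∑ i ∈ range Nc, (Set.Iio r).indicator (1 : ℝ≥0 → ℝ) (u i) *
      (J (u (i + 1)) ω - J (u i) ω) ^ 2 - ∫ s in (0 : ℝ)..(r : ℝ), σ s.toNNReal ω ^ 2|} ⊆
      (E1a ∪ E1b) ∪ E2 ∪ E3 := by
    intro ω hω
    by_contra hcon
    simp only [Set.mem_union, not_or] at hcon
    obtain ⟨⟨⟨h1a, h1b⟩, h2⟩, h3⟩ := hcon
    simp only [hE3, Set.mem_union, not_or, Set.mem_setOf_eq, not_le] at h3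
    obtain ⟨h3a, h3b⟩ := h3
    simp only [hE1a, hE1b, hE2, Set.mem_setOf_eq, not_le] at h1a h1b h2 hω
    -- abbreviations
    set dJ : ℕ → ℝ := fun i ↦ J (u (i + 1)) ω - J (u i) ω with hdJ
    set dM : ℕ → ℝ := fun i ↦ R.integral brownian (u (i + 1)) ω - R.integral brownian (u i) ω with hdM
    set w : ℕ → ℝ := fun i ↦ (Set.Iio r).indicator (1 : ℝ≥0 → ℝ) (u i) with hw
    have hw1 : ∀ i, |w i| ≤ 1 := by
      intro i; simp only [hw]
      by_cases h : u i ∈ Set.Iio r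
      · rw [Set.indicator_of_mem h]; simp
      · rw [Set.indicator_of_notMem h]; simp
    have hde : ∀ i, (J (u (i + 1)) ω - (H k).integral brownian (u (i + 1)) ω) -
        (J (u i) ω - (H k).integral brownian (u i) ω) = dJ i - dM i := by
      intro i; simp only [hdJ, hdM, hRint]; ring
    simp only [hde] at h1a
    -- (1) `|QSʷ(J) - QSʷ(M)| < η/3`
    have hQSM : ∑ i ∈ range Nc, (dJ i + dM i) ^ 2 < b := by
      have : ∀ i ∈ range Nc, (dJ i + dM i) ^ 2 ≤ 2 * (dJ i - dM i) ^ 2 + 8 * dM i ^ 2 := by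
        intro i _; nlinarith [sq_nonneg (dJ i - dM i - 2 * dM i), sq_nonneg (dJ i - 3 * dM i)]
      calc ∑ i ∈ range Nc, (dJ i + dM i) ^ 2
          ≤ ∑ i ∈ range Nc, (2 * (dJ i - dM i) ^ 2 + 8 * dM i ^ 2) := sum_le_sum this
        _ = 2 * ∑ i ∈ range Nc, (dJ i - dM i) ^ 2 + 8 * ∑ i ∈ range Nc, dM i ^ 2 := by
            rw [sum_add_distrib, mul_sum, mul_sum]
        _ < 2 * (b / 4) + 8 * (b / 16) := by
            have := min_le_right a (b / 4)
            nlinarith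
        _ = b := by ring
    have hpart1 : |∑ i ∈ range Nc, w i * dJ i ^ 2 - ∑ i ∈ range Nc, w i * dM i ^ 2| < η / 3 := by
      have hCS := Finset.sum_mul_sq_le_sq_mul_sq (range Nc) (fun i ↦ |dJ i - dM i|) (fun i ↦ |dJ i + dM i|)
      simp only [sq_abs] at hCS
      have hbound : |∑ i ∈ range Nc, w i * dJ i ^ 2 - ∑ i ∈ range Nc, w i * dM i ^ 2| ≤
          ∑ i ∈ range Nc, |dJ i - dM i| * |dJ i + dM i| := by
        rw [← sum_sub_distrib]
        refine (abs_sum_le_sum_abs _ _).trans (sum_le_sum fun i _ ↦ ?_)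
        rw [← mul_sub, abs_mul, show dJ i ^ 2 - dM i ^ 2 = (dJ i - dM i) * (dJ i + dM i) by ring, abs_mul]
        calc |w i| * (|dJ i - dM i| * |dJ i + dM i|) ≤ 1 * (|dJ i - dM i| * |dJ i + dM i|) :=
              mul_le_mul_of_nonneg_right (hw1 i) (by positivity)
          _ = _ := one_mul _
      have hlt : (∑ i ∈ range Nc, |dJ i - dM i| * |dJ i + dM i|) ^ 2 < (η / 3) ^ 2 := by
        calc (∑ i ∈ range Nc, |dJ i - dM i| * |dJ i + dM i|) ^ 2
            ≤ (∑ i ∈ range Nc, (dJ i - dM i) ^ 2) * ∑ i ∈ range Nc, (dJ i + dM i) ^ 2 := hCS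
          _ < a * b := by
              have h0 : 0 ≤ ∑ i ∈ range Nc, (dJ i + dM i) ^ 2 := sum_nonneg fun i _ ↦ sq_nonneg _
              have h0' : 0 ≤ ∑ i ∈ range Nc, (dJ i - dM i) ^ 2 := sum_nonneg fun i _ ↦ sq_nonneg _
              have ha' : ∑ i ∈ range Nc, (dJ i - dM i) ^ 2 < a := h1a.trans_le (min_le_left _ _)
              calc (∑ i ∈ range Nc, (dJ i - dM i) ^ 2) * ∑ i ∈ range Nc, (dJ i + dM i) ^ 2
                  ≤ a * ∑ i ∈ range Nc, (dJ i + dM i) ^ 2 := mul_le_mul_of_nonneg_right ha'.le h0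
                _ < a * b := mul_lt_mul_of_pos_left hQSM hapos
          _ = (η / 3) ^ 2 := by rw [ha]; field_simp
      have hnn : 0 ≤ ∑ i ∈ range Nc, |dJ i - dM i| * |dJ i + dM i| :=
        sum_nonneg fun i _ ↦ by positivity
      exact hbound.trans_lt (abs_lt_of_sq_lt_sq' hlt (by positivity)).2
    -- (2) `|QSʷ(M) - ∑ w R² Δ| < η/3` is `h2`
    -- (3a) the straddling cell: `|∑ w R² Δ - ∫_{[0,r]} R²| ≤ C'² t/2ⁿ < η/6`
    have hpart3a := R.abs_sum_indicator_sq_mul_sub_setIntegral_le hCR t hr (by positivity) hmesh ω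
    rw [show max C' 0 = C' by simp [hC']] at hpart3a
    -- (3b) `|∫_{[0,r]} Hₖ² - ∫_{[0,r]} σ²| < η/6`
    have hσω : Measurable fun s : ℝ ↦ σ s.toNNReal ω := hσj.comp measurable_prodMk_left
    have hHω : Measurable fun s : ℝ ↦ (H k).toProcess s.toNNReal ω :=
      (H k).measurable_toProcess_prod.comp measurable_prodMk_left
    have hσ2int : IntegrableOn (fun s : ℝ ↦ σ s.toNNReal ω ^ 2) (Set.Icc 0 t) := by
      refine ⟨((hσω.pow_const 2).aestronglyMeasurable), ?_⟩
      rw [hasFiniteIntegral_iff_ofReal (ae_of_all _ fun s ↦ sq_nonneg _)]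
      exact h3b.trans (ENNReal.natCast_lt_top L)
    have hreal1 : ∫ s in Set.Icc (0 : ℝ) t, ((H k).toProcess s.toNNReal ω - σ s.toNNReal ω) ^ 2 < κ := by
      have hm : AEStronglyMeasurable (fun s : ℝ ↦ ((H k).toProcess s.toNNReal ω - σ s.toNNReal ω) ^ 2)
          (volume.restrict (Set.Icc (0 : ℝ) t)) := ((hHω.sub hσω).pow_const 2).aestronglyMeasurable
      rw [integral_eq_lintegral_of_nonneg_ae (ae_of_all _ fun s ↦ sq_nonneg _) hm]
      exact ENNReal.toReal_lt_of_lt_ofReal h3a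
    have hreal2 : ∫ s in Set.Icc (0 : ℝ) t, σ s.toNNReal ω ^ 2 < L := by
      rw [integral_eq_lintegral_of_nonneg_ae (ae_of_all _ fun s ↦ sq_nonneg _)
        ((hσω.pow_const 2).aestronglyMeasurable)]
      have : (L : ℝ≥0∞) = ENNReal.ofReal L := (ENNReal.ofReal_natCast L).symm
      rw [this] at h3b
      exact ENNReal.toReal_lt_of_lt_ofReal h3b
    have hpart3b : |(∫ s in Set.Icc (0 : ℝ) r, ((H k).toProcess s.toNNReal ω) ^ 2) -
        ∫ s in Set.Icc (0 : ℝ) r, σ s.toNNReal ω ^ 2| < θ := by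
      have h := abs_setIntegral_sq_sub_sq_le (t := (t : ℝ)) hHω hσω ((H k).integrableOn_toProcess_sq_real t ω)
        hσ2int (r := (r : ℝ)) (NNReal.coe_le_coe.2 hr) hlampos
      refine h.trans_lt ?_
      have e1 : (1 / (2 * lam) + lam) * κ = θ / 2 := by
        rw [hκ]; field_simp
      have e2 : 4 * lam * L ≤ θ / 2 := by
        rw [hlam]
        rw [show 4 * (θ / (8 * (L : ℝ) + 8)) * L = θ / 2 * ((L : ℝ) / ((L : ℝ) + 1)) by field_simp; ring]
        exact mul_le_of_le_one_right (by positivity) ((div_le_one (by positivity)).2 (by linarith))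
      have i1 : 0 ≤ ∫ s in Set.Icc (0 : ℝ) t, σ s.toNNReal ω ^ 2 := integral_nonneg fun s ↦ sq_nonneg _
      calc (1 / (2 * lam) + lam) * (∫ s in Set.Icc (0 : ℝ) t,
            ((H k).toProcess s.toNNReal ω - σ s.toNNReal ω) ^ 2) +
            4 * lam * ∫ s in Set.Icc (0 : ℝ) t, σ s.toNNReal ω ^ 2
          < (1 / (2 * lam) + lam) * κ + 4 * lam * L := by
            apply add_lt_add_of_lt_of_le
            · exact mul_lt_mul_of_pos_left hreal1 (by positivity)
            · exact mul_le_mul_of_nonneg_left hreal2.le (by positivity)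
        _ ≤ θ / 2 + θ / 2 := by rw [e1]; linarith
        _ = θ := by ring
    -- assemble the contradiction
    have hI : (∫ s in (0 : ℝ)..(r : ℝ), σ s.toNNReal ω ^ 2) = ∫ s in Set.Icc (0 : ℝ) r, σ s.toNNReal ω ^ 2 := by
      rw [intervalIntegral.integral_of_le (NNReal.coe_nonneg r), integral_Icc_eq_integral_Ioc]
    have hRr : (∫ s in Set.Icc (0 : ℝ) r, (R.toProcess s.toNNReal ω) ^ 2) =
        ∫ s in Set.Icc (0 : ℝ) r, ((H k).toProcess s.toNNReal ω) ^ 2 := by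
      simp only [hRproc]
    rw [hI] at hω
    rw [hRr] at hpart3a
    -- rewrite the target sum in the `w, dJ` notation
    have hωsum : ∑ i ∈ range Nc, (Set.Iio r).indicator (1 : ℝ≥0 → ℝ) (u i) * (J (u (i + 1)) ω - J (u i) ω) ^ 2 =
        ∑ i ∈ range Nc, w i * dJ i ^ 2 := rfl
    have h2sum : ∑ i ∈ range Nc, (Set.Iio r).indicator (1 : ℝ≥0 → ℝ) (u i) *
        ((R.integral brownian (min t (R.time (i + 1))) ω - R.integral brownian (min t (R.time i)) ω) ^ 2 -
          R.value i ω ^ 2 * ((((min t (R.time (i + 1))) : ℝ≥0) : ℝ) - (min t (R.time i) : ℝ≥0))) =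
        ∑ i ∈ range Nc, w i * dM i ^ 2 - ∑ i ∈ range Nc, (Set.Iio r).indicator (1 : ℝ≥0 → ℝ) (min t (R.time i)) *
          (R.value i ω ^ 2 * ((((min t (R.time (i + 1))) : ℝ≥0) : ℝ) - (min t (R.time i) : ℝ≥0))) := by
      rw [← sum_sub_distrib]
      refine sum_congr rfl fun i _ ↦ ?_
      simp only [hw, hdM, hu]; ring
    rw [hωsum] at hω
    rw [h2sum] at h2
    have key : |∑ i ∈ range Nc, w i * dJ i ^ 2 - ∫ s in Set.Icc (0 : ℝ) r, σ s.toNNReal ω ^ 2| < η := by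
      have tri : ∀ p q x y z : ℝ, |p - z| ≤ |p - q| + |q - x| + |x - y| + |y - z| := by
        intro p q x y z
        linarith [abs_sub_le p q z, abs_sub_le q x z, abs_sub_le x y z]
      refine (tri _ (∑ i ∈ range Nc, w i * dM i ^ 2)
        (∑ i ∈ range Nc, (Set.Iio r).indicator (1 : ℝ≥0 → ℝ) (min t (R.time i)) *
          (R.value i ω ^ 2 * ((((min t (R.time (i + 1))) : ℝ≥0) : ℝ) - (min t (R.time i) : ℝ≥0))))
        (∫ s in Set.Icc (0 : ℝ) r, ((H k).toProcess s.toNNReal ω) ^ 2) _).trans_lt ?_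
      have hθη : θ = η / 6 := rfl
      have h3a' : |∑ i ∈ range Nc, (Set.Iio r).indicator (1 : ℝ≥0 → ℝ) (min t (R.time i)) *
          (R.value i ω ^ 2 * ((((min t (R.time (i + 1))) : ℝ≥0) : ℝ) - (min t (R.time i) : ℝ≥0))) -
          ∫ s in Set.Icc (0 : ℝ) r, ((H k).toProcess s.toNNReal ω) ^ 2| < η / 6 :=
        hpart3a.trans_lt (hn2.trans_eq hθη)
      linarith [hpart3b]
    exact absurd hω (not_le.2 key)
  -- Step E: the probabilities
  have hP1a : preWienerMeasure E1a ≤ ENNReal.ofReal (ε / 8) + ENNReal.ofReal (ε / 8) := by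
    have h := measure_quadSum_err_ge_le (J := J) hσj hH hHJ t humono hut haminpos hδ'pos k
    refine h.trans (add_le_add (hK₁ k hk1) (le_of_eq ?_))
    congr 1
    rw [hδ']; field_simp; ring
  have hP1b : preWienerMeasure E1b ≤ ENNReal.ofReal (ε / 8) + ENNReal.ofReal (ε / 8) := by
    have h := measure_quadSum_integral_ge_le_brownian R t humono (hut Nc le_rfl) (η := b / 16) (δ := L₁')
      (by positivity) hL₁'pos
    have hbad : preWienerMeasure {ω | L₁' < ∫ s in Set.Icc (0 : ℝ) t, (R.toProcess s.toNNReal ω) ^ 2} ≤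
        ENNReal.ofReal (ε / 8) := by
      simp only [hRproc]; exact hL₁'' k
    calc preWienerMeasure E1b ≤ preWienerMeasure ((E1b \
          {ω | L₁' < ∫ s in Set.Icc (0 : ℝ) t, (R.toProcess s.toNNReal ω) ^ 2}) ∪
          {ω | L₁' < ∫ s in Set.Icc (0 : ℝ) t, (R.toProcess s.toNNReal ω) ^ 2}) :=
        measure_mono fun ω hω ↦ (em (ω ∈ {ω | L₁' < ∫ s in Set.Icc (0 : ℝ) t,
          (R.toProcess s.toNNReal ω) ^ 2})).elim Or.inr (fun h ↦ Or.inl ⟨hω, h⟩)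
      _ ≤ preWienerMeasure (E1b \
          {ω | L₁' < ∫ s in Set.Icc (0 : ℝ) t, (R.toProcess s.toNNReal ω) ^ 2}) +
          preWienerMeasure {ω | L₁' < ∫ s in Set.Icc (0 : ℝ) t, (R.toProcess s.toNNReal ω) ^ 2} :=
        measure_union_le _ _
      _ ≤ ENNReal.ofReal (L₁' / (b / 16)) + ENNReal.ofReal (ε / 8) := add_le_add h hbad
      _ = ENNReal.ofReal (ε / 8) + ENNReal.ofReal (ε / 8) := by
          congr 1; rw [hb]; field_simp; ring_nf
  have hP2 : preWienerMeasure E2 ≤ ENNReal.ofReal (ε / 8) := by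
    have hw1 : ∀ i, |(Set.Iio r).indicator (1 : ℝ≥0 → ℝ) (u i)| ≤ 1 := by
      intro i
      by_cases h : u i ∈ Set.Iio r
      · rw [Set.indicator_of_mem h]; simp
      · rw [Set.indicator_of_notMem h]; simp
    have h := measure_weightedQuadSum_sub_ge_le R hCR hw1 t (δ := (t : ℝ) / 2 ^ n) (by positivity) hmesh
      (η := η / 3) (by positivity)
    exact h.trans (ENNReal.ofReal_le_ofReal hn1)
  have hP3 : preWienerMeasure E3 ≤ ENNReal.ofReal (ε / 8) + ENNReal.ofReal (ε / 8) :=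
    (measure_union_le _ _).trans (add_le_add (hK₂ k hk2) hL)
  -- total
  calc preWienerMeasure {ω | η ≤ |∑ i ∈ range Nc, (Set.Iio r).indicator (1 : ℝ≥0 → ℝ) (u i) *
        (J (u (i + 1)) ω - J (u i) ω) ^ 2 - ∫ s in (0 : ℝ)..(r : ℝ), σ s.toNNReal ω ^ 2|}
      ≤ preWienerMeasure ((E1a ∪ E1b) ∪ E2 ∪ E3) := measure_mono hcover
    _ ≤ ((preWienerMeasure E1a + preWienerMeasure E1b) + preWienerMeasure E2) + preWienerMeasure E3 :=
        (measure_union_le _ _).trans (add_le_add ((measure_union_le _ _).trans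
          (add_le_add (measure_union_le _ _) le_rfl)) le_rfl)
    _ ≤ ((ENNReal.ofReal (ε / 8) + ENNReal.ofReal (ε / 8) + (ENNReal.ofReal (ε / 8) + ENNReal.ofReal (ε / 8))) +
          ENNReal.ofReal (ε / 8)) + (ENNReal.ofReal (ε / 8) + ENNReal.ofReal (ε / 8)) := by
        gcongr
    _ = ENNReal.ofReal (7 * (ε / 8)) := by
        rw [← ENNReal.ofReal_add hε8.le hε8.le, ← ENNReal.ofReal_add (by positivity) (by positivity),
          ← ENNReal.ofReal_add (by positivity) hε8.le, ← ENNReal.ofReal_add (by positivity) (by positivity)]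
        congr 1; ring
    _ ≤ ENNReal.ofReal ε := ENNReal.ofReal_le_ofReal (by linarith)

/-! ### CORE 1: Riemann sums of `Z` against `J` converge to `K = ∫ σ Z dB` -/

/-- The elementary integral is additive in the integrator. [folklore] -/
theorem SimpleProcess.integral_sub_integrator {Ω : Type*} {m : MeasurableSpace Ω}
    {𝓕 : Filtration ℝ≥0 m} (H : SimpleProcess m 𝓕) (Y₁ Y₂ : ℝ≥0 → Ω → ℝ) (r : ℝ≥0) (ω : Ω) :
    H.integral (Y₁ - Y₂) r ω = H.integral Y₁ r ω - H.integral Y₂ r ω := by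
  simp only [SimpleProcess.integral, Pi.sub_apply, ← sum_sub_distrib]
  refine sum_congr rfl fun i _ ↦ ?_
  ring

/-- An elementary integral against an integrator which is uniformly small on `[0, t]` is small:
`|(H · Y)_t| ≤ 2 max(C,0) N sup_{s ≤ t} |Y_s|` (`N` cells, `|Hᵢ| ≤ C`). [folklore] -/
theorem SimpleProcess.abs_integral_le_of_forall_abs_le {Ω : Type*} {m : MeasurableSpace Ω}
    {𝓕 : Filtration ℝ≥0 m} (H : SimpleProcess m 𝓕) {C : ℝ} (hC : ∀ i ω, |H.value i ω| ≤ C)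
    {Y : ℝ≥0 → Ω → ℝ} {t : ℝ≥0} {ω : Ω} {e : ℝ} (hY : ∀ s ≤ t, |Y s ω| ≤ e) :
    |H.integral Y t ω| ≤ (H.times.length - 1 : ℕ) * (max C 0 * (2 * e)) := by
  unfold SimpleProcess.integral
  refine (abs_sum_le_sum_abs _ _).trans ?_
  calc ∑ i ∈ range (H.times.length - 1), |H.value i ω * (Y (min t (H.time (i + 1))) ω - Y (min t (H.time i)) ω)|
      ≤ ∑ i ∈ range (H.times.length - 1), max C 0 * (2 * e) := by
        refine sum_le_sum fun i _ ↦ ?_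
        rw [abs_mul]
        refine mul_le_mul ((hC i ω).trans (le_max_left _ _)) ?_ (abs_nonneg _) (le_max_right _ _)
        calc |Y (min t (H.time (i + 1))) ω - Y (min t (H.time i)) ω|
            ≤ |Y (min t (H.time (i + 1))) ω| + |Y (min t (H.time i)) ω| := abs_sub _ _
          _ ≤ e + e := add_le_add (hY _ (min_le_left _ _)) (hY _ (min_le_left _ _))
          _ = 2 * e := by ring
    _ = (H.times.length - 1 : ℕ) * (max C 0 * (2 * e)) := by rw [sum_const, card_range, nsmul_eq_mul]

/-- **The basic estimate for elementary Itô integrals, difference form**: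
`P ({sup_{s ≤ t} |(H · B)ₛ| ≥ ε} ∖ {∫₀ᵗ H² ds > η}) ≤ η / ε²` (same proof as
`measure_sup_integral_ge_le_brownian`: truncation, Doob's inequality and the Itô isometry).
Revuz–Yor, *Continuous Martingales and Brownian Motion* (1999), Ch. IV, Thm (2.12). [folklore] -/
theorem measure_sup_integral_diff_le_brownian
    (S : SimpleProcess (inferInstance : MeasurableSpace (ℝ≥0 → ℝ)) RandomPlanarGeometry.brownianFiltration)
    {ε η : ℝ} (hε : 0 < ε) (hη : 0 < η) (t : ℝ≥0) :
    preWienerMeasure ({ω | ∃ s ≤ t, ε ≤ |S.integral brownian s ω|} \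
      {ω | η < ∫ s in Set.Icc (0 : ℝ) t, (S.toProcess s.toNNReal ω) ^ 2}) ≤
      ENNReal.ofReal (η / ε ^ 2) := by
  haveI := RandomPlanarGeometry.isProbabilityMeasure_preWienerMeasure'
  set S' := S.truncate t η with hS'
  have hsub : {ω | ∃ s ≤ t, ε ≤ |S.integral brownian s ω|} \
      {ω | η < ∫ s in Set.Icc (0 : ℝ) t, (S.toProcess s.toNNReal ω) ^ 2} ⊆
      {ω | ∃ s ≤ t, ε ≤ |S'.integral brownian s ω|} := by
    rintro ω ⟨⟨s, hs, hεs⟩, hω⟩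
    refine ⟨s, hs, ?_⟩
    rwa [hS', S.integral_truncate_eq t η brownian (not_lt.1 hω)]
  refine (measure_mono hsub).trans ?_
  have hD := doob_sq_maximal_ineq_of_continuous (martingale_integral_brownian S') (memLp_two_integral_brownian S')
    (ae_of_all _ fun ω ↦ S'.continuous_integral (continuous_brownian ω)) hε t (μ := preWienerMeasure)
  refine hD.trans (ENNReal.ofReal_le_ofReal (div_le_div_of_nonneg_right ?_ (sq_nonneg ε)))
  rw [itoIsometry_simple_holds S' t]
  calc ∫ ω, (∫ s in Set.Icc (0 : ℝ) t, (S'.toProcess s.toNNReal ω) ^ 2) ∂preWienerMeasure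
      ≤ ∫ _, η ∂preWienerMeasure :=
        integral_mono_of_nonneg (ae_of_all _ fun ω ↦ integral_nonneg fun s ↦ sq_nonneg _)
          (integrable_const η) (ae_of_all _ fun ω ↦ S.setIntegral_toProcess_truncate_sq_le t hη.le ω)
    _ = η := by simp

/-- **CORE 1 — left-point Riemann sums of `Z` against `J = ∫ σ dB` converge to `K = ∫ σ Z dB` in
probability, uniformly in the refining simple process.** Let `Hₙ → σ` (approximating sequence,
`σ` jointly measurable, `∫₀ᵗ σ² < ∞` a.s.) with `Hₙ · B → J` u.c.p., let `Z` be adapted, jointly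
measurable, with a.s. continuous paths, and let `K` be an Itô integral of `σ Z`
(`IsItoIntegral`). For the partitions `U = gridTimes (H k) t n`, the clamped sampled processes
`Γ = sampleOn Z U C` and `η, ε > 0`: for `n ≥ N₀` and every `k`,
`P ({η ≤ |(Γ · J)_t - K_t|} ∩ {sup_{s ≤ t} |Z_s| ≤ C}) ≤ ε`, where
`(Γ · J)_t = ∑ᵢ clamp C (Z_{Uᵢ}) (J_{t ∧ Uᵢ₊₁} - J_{t ∧ Uᵢ})` (`integral_sampleOn`).
Proof: `K = lim (Γₘ H_{φ m}) · B = lim Γₘ · (H_{φ m} · B)` (`isApproxSeq_sample_mul`,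
associativity), `Γ · J ≈ Γ · (H_{φ m} · B)` (u.c.p.), and
`(Γ - Γₘ) · (H_{φ m} · B) = ((Γ - Γₘ) H_{φ m}) · B` is small by the basic estimate, since
`∫₀ᵗ (Γ - Γₘ)² H_{φ m}² ≤ θ² ∫₀ᵗ H_{φ m}²` off a modulus-of-continuity event.
Le Gall (2016), Prop. 5.9 and proof of Thm 5.10; Revuz–Yor (1999), Ch. IV, Prop. (2.4),
Thm (2.12), Prop. (2.13). [folklore] -/
theorem exists_forall_measure_riemannSum_sub_ge_le
    (hσj : Measurable fun p : (ℝ≥0 → ℝ) × ℝ ↦ σ p.2.toNNReal p.1)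
    (hH : SimpleProcess.IsApproxSeq H σ preWienerMeasure)
    (hHJ : TendstoUCP (fun n ↦ (H n).integral brownian) J preWienerMeasure)
    (hfin : ∀ᵐ ω ∂preWienerMeasure, ∀ t : ℝ≥0,
      ∫⁻ s in Set.Icc (0 : ℝ) t, ENNReal.ofReal (σ s.toNNReal ω ^ 2) < ∞)
    {Z K : ℝ≥0 → (ℝ≥0 → ℝ) → ℝ} (hZj : Measurable fun p : (ℝ≥0 → ℝ) × ℝ ↦ Z p.2.toNNReal p.1)
    (hZa : Adapted RandomPlanarGeometry.brownianFiltration Z) (hZc : ∀ᵐ ω ∂preWienerMeasure, Continuous (Z · ω))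
    (hK : IsItoIntegral (fun s ω ↦ σ s ω * Z s ω) brownian K RandomPlanarGeometry.brownianFiltration preWienerMeasure)
    (t : ℝ≥0) {C : ℝ} (hC : 0 ≤ C) {η : ℝ} (hη : 0 < η) {ε : ℝ} (hε : 0 < ε) :
    ∃ N₀, ∀ n ≥ N₀, ∀ k,
      preWienerMeasure ({ω | η ≤ |(SimpleProcess.sampleOn Z hZa ((H k).gridTimes t n)
          ((H k).sortedLT_gridTimes t n) C).integral J t ω - K t ω|} ∩
        {ω | ∀ s ≤ t, |Z s ω| ≤ C}) ≤ ENNReal.ofReal ε := by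
  haveI := RandomPlanarGeometry.isProbabilityMeasure_preWienerMeasure'
  have hε6 : 0 < ε / 6 := by positivity
  have hε6' : (0 : ℝ≥0∞) < ENNReal.ofReal (ε / 6) := ENNReal.ofReal_pos.2 hε6
  -- the approximating sequence of `σ Z` and the limits
  obtain ⟨φ, hφ, hφH⟩ := exists_fast_isApproxSeq hH
  have hG : SimpleProcess.IsApproxSeq (fun m ↦ (SimpleProcess.sample Z hZa m).mul (H (φ m)))
      (fun s ω ↦ σ s ω * Z s ω) preWienerMeasure := isApproxSeq_sample_mul hσj hZj hZa hZc hfin hφH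
  have hGK : TendstoUCP (fun m ↦ ((SimpleProcess.sample Z hZa m).mul (H (φ m))).integral brownian) K
      preWienerMeasure := hK.2.2.2.2 _ hG
  have hφJ : TendstoUCP (fun m ↦ (H (φ m)).integral brownian) J preWienerMeasure := by
    intro t' e he
    exact (hHJ t' e he).comp (tendsto_atTop_atTop.2 fun b ↦ ⟨b, fun a ha ↦ ha.trans (hφ a)⟩)
  -- constants
  obtain ⟨L₁, hL₁⟩ := exists_forall_measure_setIntegral_sq_gt_le (P := preWienerMeasure) hσj hH t
    (by filter_upwards [hfin] with ω hω using hω t) hε6'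
  set L₁' : ℝ := max L₁ 1 with hL₁'
  have hL₁'pos : 0 < L₁' := lt_of_lt_of_le one_pos (le_max_right _ _)
  have hL₁'' : ∀ k, preWienerMeasure {ω | L₁' < ∫ s in Set.Icc (0 : ℝ) t,
      ((H k).toProcess s.toNNReal ω) ^ 2} ≤ ENNReal.ofReal (ε / 6) := fun k ↦
    (measure_mono fun ω (hω : L₁' < _) ↦ lt_of_le_of_lt (le_max_left _ _) hω).trans (hL₁ k)
  set δ₀ : ℝ := (η / 3) ^ 2 * (ε / 6) with hδ₀
  have hδ₀pos : 0 < δ₀ := by positivity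
  set θ : ℝ := Real.sqrt (δ₀ / L₁') with hθ
  have hθpos : 0 < θ := Real.sqrt_pos.2 (by positivity)
  have hθL : θ ^ 2 * L₁' = δ₀ := by
    rw [hθ, Real.sq_sqrt (by positivity)]; field_simp
  have hZm : ∀ s : ℝ≥0, Measurable (Z s) := by
    intro s
    have h := hZj.comp (measurable_id.prodMk (measurable_const (a := (s : ℝ))))
    simpa [Function.comp_def, Real.toNNReal_coe] using h
  obtain ⟨ρ, hρ, hmod⟩ := exists_measure_modulus_gt_le (P := preWienerMeasure) hZm hZc t hθpos hε6'
  -- `n`-threshold: mesh `t/2ⁿ ≤ ρ/2`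
  have hmesh0 : Tendsto (fun n : ℕ ↦ (t : ℝ) / 2 ^ n) atTop (𝓝 0) := by
    have := (tendsto_pow_atTop_nhds_zero_of_lt_one (r := (1 / 2 : ℝ)) (by norm_num) (by norm_num)).const_mul (t : ℝ)
    rw [mul_zero] at this
    refine this.congr fun n ↦ ?_
    rw [one_div, inv_pow, div_eq_mul_inv]
  obtain ⟨N₀, hN₀⟩ := eventually_atTop.1 (hmesh0.eventually (ge_mem_nhds (half_pos hρ)))
  refine ⟨N₀, fun n hn k ↦ ?_⟩
  have hn' : (t : ℝ) / 2 ^ n ≤ ρ / 2 := hN₀ n hn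
  -- notation
  set U := (H k).gridTimes t n with hU
  set Γ := SimpleProcess.sampleOn Z hZa U ((H k).sortedLT_gridTimes t n) C with hΓ
  set R := (H k).gridRefine t n with hR
  have hRtime : ∀ i, R.time i = Γ.time i := fun i ↦ rfl
  have hRlen : R.times.length = Γ.times.length := rfl
  set Good : Set (ℝ≥0 → ℝ) := {ω | ∀ s ≤ t, |Z s ω| ≤ C} with hGood
  set ModBad : Set (ℝ≥0 → ℝ) := {ω | ∃ s ≤ t, ∃ s' ≤ t, |(s : ℝ) - s'| ≤ ρ ∧ θ < |Z s ω - Z s' ω|} with hModBad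
  have hCΓ : ∀ i ω, |Γ.value i ω| ≤ C := fun i ω ↦
    (SimpleProcess.abs_sampleOn_value_le Z hZa U _ C i ω).trans (abs_of_nonneg hC).le
  -- for each `m`, the three-term decomposition
  set Y : ℕ → ℝ≥0 → (ℝ≥0 → ℝ) → ℝ := fun m ↦ (H (φ m)).integral brownian with hY
  set Ncell : ℕ := Γ.times.length - 1 with hNcell
  have hηA : 0 < η / 3 / ((Ncell : ℝ) * (max C 0 * 2) + 1) := by positivity
  set Am : ℕ → Set (ℝ≥0 → ℝ) := fun m ↦ {ω | ∃ s ≤ t, η / 3 / ((Ncell : ℝ) * (max C 0 * 2) + 1) ≤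
    |Y m s ω - J s ω|} with hAm
  set Cm : ℕ → Set (ℝ≥0 → ℝ) := fun m ↦ {ω | ∃ s ≤ t, η / 3 ≤
    |((SimpleProcess.sample Z hZa m).mul (H (φ m))).integral brownian s ω - K s ω|} with hCm
  set Sm : ℕ → SimpleProcess (inferInstance : MeasurableSpace (ℝ≥0 → ℝ)) RandomPlanarGeometry.brownianFiltration :=
    fun m ↦ (Γ.sub (SimpleProcess.sample Z hZa m)).mul (H (φ m)) with hSm
  set Bm : ℕ → Set (ℝ≥0 → ℝ) := fun m ↦ {ω | ∃ s ≤ t, η / 3 ≤ |(Sm m).integral brownian s ω|} with hBm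
  set Dm : ℕ → Set (ℝ≥0 → ℝ) := fun m ↦ {ω | δ₀ < ∫ s in Set.Icc (0 : ℝ) t, ((Sm m).toProcess s.toNNReal ω) ^ 2}
    with hDm
  set Lm : ℕ → Set (ℝ≥0 → ℝ) := fun m ↦ {ω | L₁' < ∫ s in Set.Icc (0 : ℝ) t,
    ((H (φ m)).toProcess s.toNNReal ω) ^ 2} with hLm
  -- Step 1: covering, for `m ≥ max t C`
  have hcover : ∀ m : ℕ, (t : ℝ) ≤ m → C ≤ m → (1 : ℝ) / 2 ^ m ≤ ρ / 2 →
      {ω | η ≤ |Γ.integral J t ω - K t ω|} ∩ Good ⊆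
        Am m ∪ (Bm m \ Dm m) ∪ (Lm m ∪ ModBad) ∪ Cm m := by
    intro m hmt hmC hmρ ω ⟨hω, hgood⟩
    simp only [Set.mem_setOf_eq] at hω
    by_cases hA : ω ∈ Am m
    · exact Or.inl (Or.inl (Or.inl hA))
    by_cases hCc : ω ∈ Cm m
    · exact Or.inr hCc
    by_cases hL : ω ∈ Lm m ∪ ModBad
    · exact Or.inl (Or.inr hL)
    left; left; right
    -- the middle term is large, and `∫ Sm² ≤ δ₀`
    simp only [hAm, hCm, Set.mem_setOf_eq, not_exists, not_and, not_le] at hA hCc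
    simp only [Set.mem_union, not_or, hLm, hModBad, Set.mem_setOf_eq, not_lt, not_exists, not_and] at hL
    obtain ⟨hL1, hL2⟩ := hL
    -- term A: `|Γ·J - Γ·Y| < η/3`
    have hTA : |Γ.integral J t ω - Γ.integral (Y m) t ω| < η / 3 := by
      rw [← Γ.integral_sub_integrator]
      have hb := Γ.abs_integral_le_of_forall_abs_le hCΓ (Y := J - Y m) (t := t) (ω := ω)
        (e := η / 3 / ((Ncell : ℝ) * (max C 0 * 2) + 1)) fun s hs ↦ by
          rw [Pi.sub_apply, Pi.sub_apply, abs_sub_comm]; exact (hA s hs).le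
      refine hb.trans_lt ?_
      rw [show (Γ.times.length - 1 : ℕ) = Ncell from rfl]
      have hpos : 0 < (Ncell : ℝ) * (max C 0 * 2) + 1 := by positivity
      calc (Ncell : ℝ) * (max C 0 * (2 * (η / 3 / ((Ncell : ℝ) * (max C 0 * 2) + 1))))
          = η / 3 * ((Ncell : ℝ) * (max C 0 * 2) / ((Ncell : ℝ) * (max C 0 * 2) + 1)) := by
            field_simp
        _ < η / 3 * 1 := by
            refine mul_lt_mul_of_pos_left ((div_lt_one hpos).2 (by linarith)) (by positivity)
        _ = η / 3 := mul_one _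
    -- term C: `|(Gₘ·B)_t - K_t| < η/3`
    have hTC := hCc t le_rfl
    -- associativity: `(Gₘ·B)_t = (Γₘ · Y)_t`, and `(Sm·B)_t = (Γ·Y)_t - (Γₘ·Y)_t`
    have hassoc : ((SimpleProcess.sample Z hZa m).mul (H (φ m))).integral brownian t ω =
        (SimpleProcess.sample Z hZa m).integral (Y m) t ω := SimpleProcess.integral_mul _ _ _ _ _
    have hSmB : (Sm m).integral brownian t ω = Γ.integral (Y m) t ω -
        (SimpleProcess.sample Z hZa m).integral (Y m) t ω := by
      simp only [hSm]
      rw [SimpleProcess.integral_mul, SimpleProcess.integral_sub]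
    -- so term B is `≥ η/3`
    have hTB : η / 3 ≤ |(Sm m).integral brownian t ω| := by
      by_contra hcon
      push Not at hcon
      rw [hSmB] at hcon
      rw [hassoc] at hTC
      have : |Γ.integral J t ω - K t ω| < η := by
        have tri : ∀ p q x z : ℝ, |p - z| ≤ |p - q| + |q - x| + |x - z| := by
          intro p q x z; linarith [abs_sub_le p q z, abs_sub_le q x z]
        linarith [tri (Γ.integral J t ω) (Γ.integral (Y m) t ω)
          ((SimpleProcess.sample Z hZa m).integral (Y m) t ω) (K t ω)]
      exact absurd hω (not_le.2 this)
    refine ⟨⟨t, le_rfl, hTB⟩, ?_⟩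
    -- `∫₀ᵗ Sm² ≤ θ² ∫₀ᵗ H² ≤ δ₀`
    simp only [hDm, Set.mem_setOf_eq, not_lt]
    have hpt : ∀ s : ℝ, s ∈ Set.Icc (0 : ℝ) t →
        ((Sm m).toProcess s.toNNReal ω) ^ 2 ≤ θ ^ 2 * ((H (φ m)).toProcess s.toNNReal ω) ^ 2 := by
      intro s hs
      simp only [hSm]
      rw [SimpleProcess.toProcess_mul, SimpleProcess.toProcess_sub, mul_pow]
      refine mul_le_mul_of_nonneg_right ?_ (sq_nonneg _)
      rw [← sq_abs]
      refine pow_le_pow_left₀ (abs_nonneg _) ?_ 2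
      rcases hs.1.eq_or_lt with h0 | hpos
      · -- `s = 0`: both step processes vanish
        rw [← h0, Real.toNNReal_zero, SimpleProcess.toProcess_zero, SimpleProcess.toProcess_zero, sub_zero,
          abs_zero]
        exact hθpos.le
      -- locate `s⁺` in a cell of `U`
      have hs0 : 0 < s.toNNReal := Real.toNNReal_pos.2 hpos
      have hst : s.toNNReal ≤ t := Real.toNNReal_le_iff_le_coe.2 hs.2
      obtain ⟨q, hq, hqt⟩ := (H k).exists_gridRefine_time_eq t n
      have h0q : 0 < q := by
        by_contra h; push Not at h
        have : q = 0 := by omega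
        rw [this, (H k).gridRefine_time_zero] at hqt
        exact absurd hqt.symm (ne_of_gt (hs0.trans_le hst))
      obtain ⟨j, -, hjq, hj⟩ := R.exists_mem_Ioc_time hq h0q
        (s := s.toNNReal) ⟨by rw [(H k).gridRefine_time_zero]; exact hs0, by rw [hqt]; exact hst⟩
      have hj1 : j + 1 < U.length := by
        have : q < R.times.length := hq
        rw [show R.times.length = U.length from rfl] at this; omega
      rw [hRtime, hRtime] at hj
      rw [SimpleProcess.toProcess_sampleOn Z hZa U _ C hj1 hj, SimpleProcess.toProcess_sample Z hZa hs0
        (hst.trans (by exact_mod_cast hmt))]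
      -- both clamps are inactive on `Good`
      have hUj : Γ.time j ≤ t := (hj.1.le.trans hst)
      have hleft := sampleLeft_le_and_sub_le (n := m) hs0
      have hLt : sampleLeft m s.toNNReal ≤ t := hleft.1.trans hst
      rw [clamp_eq_self (hgood _ hUj), clamp_eq_self ((hgood _ hLt).trans hmC)]
      -- the two sampling points are within `ρ`
      refine hL2 _ hUj _ hLt ?_
      have h1 : (s.toNNReal : ℝ) - Γ.time j ≤ (t : ℝ) / 2 ^ n := by
        have hm' := (H k).gridRefine_cappedCell_le t n (j := j) (by rw [hRlen]; exact hj1)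
        rw [hRtime, hRtime, min_eq_right hUj] at hm'
        have : (s.toNNReal : ℝ) ≤ (min t (Γ.time (j + 1)) : ℝ≥0) :=
          NNReal.coe_le_coe.2 (le_min hst hj.2)
        linarith
      have h2 := hleft.2
      have h3 : ((Γ.time j : ℝ≥0) : ℝ) ≤ s.toNNReal := NNReal.coe_le_coe.2 hj.1.le
      have h4 : ((sampleLeft m s.toNNReal : ℝ≥0) : ℝ) ≤ s.toNNReal := NNReal.coe_le_coe.2 hleft.1
      rw [abs_le]; constructor <;> linarith
    have hHω : Measurable fun s : ℝ ↦ (H (φ m)).toProcess s.toNNReal ω :=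
      (H (φ m)).measurable_toProcess_prod.comp measurable_prodMk_left
    calc ∫ s in Set.Icc (0 : ℝ) t, ((Sm m).toProcess s.toNNReal ω) ^ 2
        ≤ ∫ s in Set.Icc (0 : ℝ) t, θ ^ 2 * ((H (φ m)).toProcess s.toNNReal ω) ^ 2 :=
          setIntegral_mono_on ((Sm m).integrableOn_toProcess_sq_real t ω)
            (((H (φ m)).integrableOn_toProcess_sq_real t ω).const_mul _) measurableSet_Icc hpt
      _ = θ ^ 2 * ∫ s in Set.Icc (0 : ℝ) t, ((H (φ m)).toProcess s.toNNReal ω) ^ 2 :=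
          MeasureTheory.integral_const_mul _ _
      _ ≤ θ ^ 2 * L₁' := mul_le_mul_of_nonneg_left hL1 (sq_nonneg _)
      _ = δ₀ := hθL
  -- Step 2: probabilities, then `m → ∞`
  have hlimAC : Tendsto (fun m ↦ preWienerMeasure (Am m) + preWienerMeasure (Cm m)) atTop (𝓝 0) := by
    simpa using (hφJ t _ hηA).add (hGK t _ (by positivity : 0 < η / 3))
  have hBD : ∀ m, preWienerMeasure (Bm m \ Dm m) ≤ ENNReal.ofReal (ε / 6) := by
    intro m
    refine (measure_sup_integral_diff_le_brownian (Sm m) (by positivity : 0 < η / 3) hδ₀pos t).trans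
      (le_of_eq ?_)
    congr 1; rw [hδ₀]; field_simp
  have hev : ∀ᶠ m : ℕ in atTop, (t : ℝ) ≤ m ∧ C ≤ m ∧ (1 : ℝ) / 2 ^ m ≤ ρ / 2 := by
    refine ((tendsto_natCast_atTop_atTop.eventually_ge_atTop (t : ℝ)).and
      ((tendsto_natCast_atTop_atTop.eventually_ge_atTop C).and ?_))
    have : Tendsto (fun m : ℕ ↦ (1 : ℝ) / 2 ^ m) atTop (𝓝 0) := by
      simpa [one_div, inv_pow] using tendsto_pow_atTop_nhds_zero_of_lt_one (r := (2⁻¹ : ℝ)) (by norm_num) (by norm_num)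
    exact this.eventually (ge_mem_nhds (half_pos hρ))
  have hbound : ∀ᶠ m : ℕ in atTop, preWienerMeasure ({ω | η ≤ |Γ.integral J t ω - K t ω|} ∩ Good) ≤
      ENNReal.ofReal (ε / 6) + (ENNReal.ofReal (ε / 6) + ENNReal.ofReal (ε / 6)) +
        (preWienerMeasure (Am m) + preWienerMeasure (Cm m)) := by
    filter_upwards [hev] with m hm
    calc preWienerMeasure ({ω | η ≤ |Γ.integral J t ω - K t ω|} ∩ Good)
        ≤ preWienerMeasure (Am m ∪ (Bm m \ Dm m) ∪ (Lm m ∪ ModBad) ∪ Cm m) :=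
          measure_mono (hcover m hm.1 hm.2.1 hm.2.2)
      _ ≤ preWienerMeasure (Am m) + preWienerMeasure (Bm m \ Dm m) +
          (preWienerMeasure (Lm m) + preWienerMeasure ModBad) + preWienerMeasure (Cm m) :=
          (measure_union_le _ _).trans (add_le_add ((measure_union_le _ _).trans
            (add_le_add (measure_union_le _ _) (measure_union_le _ _))) le_rfl)
      _ ≤ preWienerMeasure (Am m) + ENNReal.ofReal (ε / 6) +
          (ENNReal.ofReal (ε / 6) + ENNReal.ofReal (ε / 6)) + preWienerMeasure (Cm m) := by
          gcongr
          · exact hBD m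
          · exact hL₁'' (φ m)
      _ = _ := by ring_nf
  have hlim2 := (tendsto_const_nhds (x := ENNReal.ofReal (ε / 6) +
    (ENNReal.ofReal (ε / 6) + ENNReal.ofReal (ε / 6)))).add hlimAC
  rw [add_zero] at hlim2
  refine (ge_of_tendsto hlim2 hbound).trans ?_
  rw [← ENNReal.ofReal_add hε6.le hε6.le, ← ENNReal.ofReal_add hε6.le (by positivity)]
  exact ENNReal.ofReal_le_ofReal (by linarith)

end Core

end Literature.Probability.Process
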